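import Summits.QuantumFields.YangMills.Theorems.BalabanUVNodesN24K1R9ByNameOfOpenStubsChildrenSplitSlot8Thm1AEAtAbstractWitnessY0
import Summits.QuantumFields.YangMills.Theorems.BalabanUVNodesN11K1ZBRoadDoorRows
import Summits.QuantumFields.YangMills.Theorems.BalabanUVNodesN13UV01LevelZeroAtThm1CCMWZBOfPrintedZ
import Literature.MathematicalPhysics.QuantumFieldTheory.Balaban1983to89.Node00.Record13LettersOfThm1CCMWZB
import Summits.QuantumFields.YangMills.Theorems.BalabanUVNodesK0AllTorusOfStepTokensGuardedZBLamSeam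
import Summits.QuantumFields.YangMills.Theorems.BalabanUVNodesN09AxialCovariance181OnDomainsReg8Nesting
import Summits.QuantumFields.YangMills.Theorems.BalabanUVNodesK0V23Stub3NonVacuity
import Summits.QuantumFields.YangMills.Theorems.BalabanUVNodesK1RunRowsBoxCongr

/-!
# NODE N24 (B2) — THE K1 ENGINE v2, COFINAL β-SOCKET EDITION: K0⁷'s β-BOX AND NODE O's RUN ROWS TAKEN AT A RADIUS SUPPLIED BY THE PRODUCER (director-ym №402 (R) «the K1 β-road socket takes the radius from the
# producer», P3 g84 spec `ENGINE-v2-cofinal-socket.md` (R1)) — ONE binder `hβc` replaces engine v2's `h3` (the ∀-radius V23 stub text) AND `hrowsRF` (the ∀-door run rows); every other binder and both conclusions as engine v2 ✓p781730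

TRACK A (YM-PLAN §2d, node N24 of 28 = binder B2), seat `pub-ymgap-dag-n24-c` (R134 s2; gen 21, INTENT-4; generator `genEngineCof.py` over the ✓p781730 tree bytes).  Key of record K1⁹ = stmt-QuantumFields-27364
(`--kind proof --supports 27364 --as helper`, Summits lane; count-neutral).  [V] = [Balaban1989LargeFieldII]; [III] = [Balaban1988Convergent]; [I] = [Balaban1987RG1]; [B11] = [Balaban1985Variational].

WHY (director-ym №402 FACT ∕ WORD (R), P3 g84 (E1)–(E3)).  Engine v2 (`…N24K1R9ByNameOfOpenStubsV23GridGBChildrenSplitSlot8Thm1AEPosN09T5AtGaussPinPrintedZBY`; read its header and «N09T5»'s for the lineage) bills its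
β-road at EVERY small radius: `h3 : AbsBetaBoxAtThm1WitnessCCMGenGridGZBAt F` (the box for every `(j c c₀ c₁ B₃ B₃′ a₀ a₁)`) and `hrowsRF` (NODE O's rows at every door `0 < a₀ ≤ 1∕(109824·L²)`), although the
engine itself works at ONE radius per family.  A NODE-O producer valid only along radii → 0 (director №398 doors (α_cof)∕(κ_cof)) or only on `]0, a⋆(F)]` ((α_small)) inhabits K0⁷ and is accepted by the
K1⁹ ITEM (θ — hence the radius — is the prover's ∃) but NOT by those two binders as typed.  WORD (R): take the box and the rows AT A RADIUS SUPPLIED BY THE PRODUCER, cofinal form.  THIS FILE does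
exactly that, everything else byte-identical to engine v2:
* DISPLAY: ONE binder `hβc : ∀ a > 0, ∃ a₀, 0 < a₀ ≤ a ∧ ∃ (γ₀ ε₂₉ β′) (j ε₀ B₃ B₃′ a₁ Efl logz), 0 < γ₀ ∧ 0 < ε₂₉ ∧ ⟨abs box of β₁₃ at θ₁₃ᶜᶜᴹᵂᶻᴮ(j; ½; a₀; ε₀, ε₂₉; B₃, B₃′, a₀, a₁; Efl, logz) on ]0, γ₀]⟩ ∧
  ∃ (b r γ₁ M), 0 < γ₁ ∧ ⟨rows (i) (iv) (C) of that β at level γ₁⟩` — the box part is the body of k0's door `K0V23Stub3DoorSuppliers.K0BoxCofinalRadii` (✓p781725) at `F`, CONJUNCT FOR CONJUNCT (so an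
  (α_cof) producer is `hβc` minus the rows, and (α_small) ∕ the every-radius core feed it through `a₀ := min a a⋆` — k0's `k0BoxCofinalRadii_of_k0BoxSmallRadii`); the rows part is K1⁹'s own rows
  conjunct at that β.  `h3` and `hrowsRF` are GONE; `Slot8 ε hεz Efl h05F h06F h07 h08 h09F hN09TF h10F h11N hEfl h13posF` and BOTH CONCLUSIONS are BYTE-IDENTICAL to engine v2 (the per-door families stay
  ∀-radius-under-the-ceiling with the pin `hε₀ρ : ε₀ = a₀` and are simply evaluated at the producer's radius).
* PROOF (the prelude only; P3 (R1) «USE in the body»): stub 1ᴮ's ∃-radius `ā` (k0 `K0V23Stub3NonVacuity.exists_radius_antecedentsZB_inhabited_below`: below `ā` the ᴮ (8)-sentence and (9)-token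
  are jointly inhabited — stub 1ᴮ PROVED `K0Stub1BHolds`, 53′, the (9)-supplier with [6] Prop. 6 printed; antitone in the radius by `Prop8RegSepTopStepGB.of_le`) and the ceiling are handed to the
  socket as `a := min ā (1∕(109824·L²))`; the socket returns `a₀ ≤ a` with the producer's letters `(j₁, ε₀₁, C₃, C₃′, c₁′, Efl₁, logz₁)`, `γ₀`, `ε₂₉`, `β′`, box, rows; the K0 DOOR is read AT THAT
  RADIUS (`(j, c′, c₀, c₁; B₃, B₉, a₁′)`, `h15`, `h9`); the box is RE-LETTERED to the door's letter-free member by the census (`rfl`: β₁₃ at the half-window Z3 member reads `(F; a₀, ε₂₉)` only — k0's `K0V23Stub3Sockets.betaOfRecord₁₃_zbRegime_letterBlind`,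
  stated inline to stay off the Theses cone), the window SHRUNK to `0 < γ ≤ ½` with the two letters (n07-w3's `K1RunwiseLettersOfBoxH.windowLetters_of_absBoxH`),
  transported to the window edition by node00's `betaLowerH∕UpperH_theta13OfThm1CCMWZB_of_half`; NODE O's ROWS are moved to the engine's window-edition member by this seat's
  `K1RunRowsBoxCongr.runRows_theta13OfThm1CCMWZB_window_of_half` (✓ INTENT-4a: the four rows READ β ONLY ON THE BOXES OF THEIR LEVEL — `Y ∕ clampPrefix ∕ Survivors ∕ SurvCont ∕ RGEqH ∕
  RunConstRemainder ∕ partial sums` congruence under agreement on `]0, γ]^(k+1)`, level landing at `min γ₁ γ`; the two members' β's agree there by node00's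
  `betaOfRecord₁₃_theta13OfThm1CCMWZB_eq_of_mem` + the census) and replace BOTH reads of `hrowsRF` (N13's level-0 partial-sum floor; the final `exact`'s rows).  From `hloW ∕ hupW` on, every
  proof byte is engine v2's (`ε₀ := a₀` pinned by `hε₀def`, `hbg₀` by `2 ≤ L²`, NODE 00's comparability rows, the ᴮ grid-guard provisos `…GuardedZBLam` + `hDat_dataSmall7LamTopOf` + `hseam_holds`,
  dag-n11-d's four door rows + `h11`, N13's `h13` assembly, the two L-only [B7] numerics rows, N09's door `hle := le_rfl`, Y0 ed.2's `…_atWitness_pinY₀_of_runRowsCont`).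
WHAT (R1) ACCEPTS BY NAME (P3 §3): an (α_cof) producer (+ its rows); (α_small) and the every-radius cores via `min`.  WHAT IT DOES NOT (P3 §4): a (κ_cof)-only (comparability) producer — the β-road
here READS THE BOX (comparability rows, N11's operand rows); a comparability-keyed K1 socket is not in the tree and is not typed here.  PER-DOOR CAVEAT unchanged from «N09T5» (V-579): the OTHER
per-door families are still demanded at every small-ceiling door pinned in `ε₀`; joint inhabitation across their letters is not claimed.

WHAT THIS FILE PROVES (2 theorems, 0 `def`, 0 `sorry`; standard axioms; `N = 2`).
§1 `N24_stabilityBRunRowsR13SepCoPHV_consequent_of_cofinalBetaSocketZBV23_of_childrenSplitSlot8DoorPinnedN09Thm3InputsN11SupplierRowsThm1AEPos_atGaussPinPrintedZB_pinY` — per `F`: K1⁹'s consequent at `F` from the COFINAL β-SOCKET `hβc`, the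
   road-free slot families read at `θᴳᶻᴮ(π)` (N05 at `Slot8`; N07, N08, N09's Lemma-4 leaf `h09F` + its eight Theorem-3 INPUT rows `hN09TF`; N10 `h10F`; N11's `h11N`; N06 = the carrier-generic SOCKET `h06F`), `hEfl`,
   N13's a.e. rows at levels ≥ 1; level 0 by (Z-6).
§2 ★★★★ `N24_stabilityBRunRowsAtRecordR13SepCoPHV_byName_of_cofinalBetaSocketZBV23_of_childrenSplitSlot8DoorPinnedN09Thm3InputsN11SupplierRowsThm1AEPos_atGaussPinPrintedZB_pinY` — K1⁹ BY ITS ROUTE NAME (`intro F _; exact §1 …`).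

WHICH CHILD BLOCKS AT THE Z3 GAUSS PIN (kernel form = §2's hypotheses): K0⁷ ⊕ NODE O = `hβc` (the cofinal β-socket: abs box + run rows at a producer radius — NODE O's wall in the (α_cof) currency; K0's stub 1ᴮ
proved, 2′ printed, consumed inside); N05 `h05` at `Slot8`; N07 `h07`; N08 `h08`; N09 `h09` + `hN09T`; N10 `h10`; N11 `h11N`; N13 levels ≥ 1 (`h13pos`) + `hEfl`; `0 < ε`.  SOCKET (junk-inhabitable, V-555): N06 `h06`.

HONEST FRAMING.  Composition BY NAME on green homes; NO estimate of Bałaban's proved here; every family DISPLAYED as a hypothesis (CONDITIONAL, audit `proof.conditional`); `Efl`, `ε` FREE; NOT a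
claim that the Z3 member IS K1⁹'s witness; `hβc` is NOBODY's theorem (NODE O's wall; director №398∕№399 doors) — displayed, not resolved; N05 ∕ N06 ∕ N07 ∕ N09 ∕ N11 ∕ N13 NOT discharged; N24
COMPOSITE — no count moved (COUNT 8∕27 · K 1∕4); K0⁷ ∕ K1⁹ (DECIDING) ∕ K3⁸ OPEN; one finite 𝕋⁴ programme at fixed ε, Bałaban AS PRINTED; R4 = the conditional finite-𝕋⁴ rung `BalabanLadder.UV` only —
NOT continuum ∕ ℝ⁴ ∕ OS ∕ mass gap ∕ Clay: the Yang–Mills mass gap is NOT proved by any of this.  No `sorry`, `def`, `instance`, `notation`.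
-/

noncomputable section

open scoped Matrix.Norms.L2Operator BigOperators
open Filter Topology MeasureTheory

namespace Summit.QuantumFields.YangMills.BalabanUVNodes.N24K1R9ByNameOfCofinalBetaSocketV23GridGBChildrenSplitSlot8Thm1AEPosN09T5AtGaussPinPrintedZBY

open Literature.MathematicalPhysics.QuantumFieldTheory.Balaban1983to89
open Literature.MathematicalPhysics.QuantumFieldTheory.Balaban1983to89.Node00
open DagBinding T4Continuum T4DatumAssembly FlowStepRuns AveragingRT
open FlowStep (HBeta RGEqH prefixOf prefixOf_apply BetaLowerH BetaUpperH Box mem_box clampPrefix Y)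
open Summit.QuantumFields.YangMills.Theorems.K0V23Stub3NonVacuity (exists_radius_antecedentsZB_inhabited_below)
open Summit.QuantumFields.YangMills.Theorems.K1RunwiseLettersOfBoxH (windowLetters_of_absBoxH)
open Summit.QuantumFields.YangMills.Theorems.K1RunRowsBoxCongr (runRows_theta13OfThm1CCMWZB_window_of_half)
open Summit.QuantumFields.YangMills.Theorems.K0AllTorusOfStepTokensGuardedZBLam (provisos₁₃SepCoP_theta13OfThm1CCMWZB_gridGuard_of_thm1RegSepCoP7MGB_of_thm1GaugeGB_lam hDat_dataSmall7LamTopOf hseam_holds)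
open Summit.QuantumFields.YangMills.Theorems.BalabanUVNodesN11GaussianCertificateDefs (gaussPinH)
open Summit.QuantumFields.YangMills.BalabanUVNodes.N09AxialCovariance181OnDomainsReg8Nesting (thm3Member_forall_stage13SepCoPH_onDomains_of_axialOn_of_reg8_of_suppPt)
open Summit.QuantumFields.YangMills.Theorems.BalabanUVNodesN11Sect3SupplyChainDefs (Sect3Supplier)
open Summit.QuantumFields.YangMills.Theorems.BalabanUVNodesN11Sect3SupplyChainObligationsDefs (SupplierObligations OperandRowsAlongChain)
open Summit.QuantumFields.YangMills.Theorems.BalabanUVNodesN11K1ZBRoadDoorRows (doorRows_gaussPinH_ofHistoryBlind_theta13OfThm1CCMWZB h11Family_gaussPinH_ofHistoryBlind_theta13OfThm1CCMWZB_of_exists_supplier_windowed)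
open Summit.QuantumFields.YangMills.BalabanUVNodes.N24K1R9ByNameOfOpenStubsChildrenSplitSlot8Thm1AEAtAbstractWitnessY0 (N24_stabilityBRunRowsR13SepCoPHV_consequent_childrenSplitSlot8Thm1AE_atWitness_pinY₀_of_runRowsCont)
open Summit.QuantumFields.YangMills.BalabanUVNodes.N13UV01LevelZeroAtThm1CCMWZBOfPrintedZ (uv_zero_densOfRecord₁₃_theta13OfThm1CCMWZB_printedZ_of_eflAbs_of_inInterval_of_runPartialSumFloor)

variable {F : T4Family} {N : ℕ} [NeZero N]

/-! ## §1–§2. `N = 2`: K1⁹'s consequent at `F` and K1⁹ BY ITS ROUTE NAME on the COFINAL β-SOCKET at the Gauss pin of the PRINTED-z member (slot road, `Slot8` parametric; N13 level 0 consumed, a.e. at levels ≥ 1 displayed) -/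

/-- **★★★ K1⁹'s θ-KEYED CONSEQUENT AT `F` ON THE V21-G K0 FACE, SLOT ROAD AT THE GAUSS-PIN CERTIFICATE OF THE PRINTED-z MEMBER, N13's LEVEL-0 FACE CONSUMED** — from V21-G's REGISTERED
two REGISTERED stubs BY NAME (`h1G3 : Prop8StepCoPGridGAt F`, `h3 : AbsBetaBoxAtThm1WitnessCCMGenGridGZAt F` — DEF-1's `K0V22ZDefs` §1; edition «N09T5», the box read at the chosen threshold `ε₀ := a₀`), the ROAD-FREE slot families READ AT `θᴳᶻᴮ(π)` (N05 at `Slot8`, N07, N08, N09's Lemma-4 leaf `h09F` AND — edition «N09T» — N09's eight THEOREM-3 INPUT rows `hN09TF : <door> → ∃ cd, hreg8 ∧ haxDom ∧ haxbg ∧ hχregpt ∧ hint ∧ h11 ∧ hres ∧ huniq` at radius `a₀` ∕ numerics `numerics7OfThm1CCM F.L j ε₀ B₃ B₃' a₀ a₁` (dag-n09-w2 FILE 7's door fed BY NAME with `hle := le_rfl`, header JUNCTION «J9T»), N10, N11's `h11N`; N06 = the carrier-generic SOCKET `h06F`, JUNK-INHABITABLE (header SOCKETS)),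
the `Efl` volume bound `hEfl`, N13's a.e. rows AT LEVELS ≥ 1 (`h13posF`, with `hP`), NODE O's run rows: p654747 §1's V21-G prelude VERBATIM (door tuple by k0-s1-w3's `gauge9SupplierG3_of_prop6MemberP`,
box read at the chosen threshold `ε₀ := a₀` from `h3` by DEF-1 g29's `forall_eps0_absBox_of_GZAt`, window letters, the GRID-GUARD z-door rows composed inline, dag-n11-w1's `antecedent_gaussPinH` ∕ rows), then p650613 §2's `h13` family ASSEMBLED from dag-n13-w1's p643638
level-0 theorem at the printed z (fed with `hrowsR`'s row (ii) and `hEfl`) and the displayed a.e. rows (`em ∕ ep := max`, `χβ ≥ 0`), then ONE `exact` of p650613 §2 at `θ := θᴳᶻ(π)`.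
CONDITIONAL; nothing of Bałaban asserted; N11 ∕ N13 NOT discharged. [cite: Balaban1989LargeFieldII, Thm 1 p.355, (0.1) pp.355–356, (0.15) p.360, p.391; Balaban1988Convergent, Theorem p.245, Cor. 3 (2.50) p.264, (0.2) p.244, (1.15) p.249, (2.1) p.254, (2.5)–(2.8) pp.255–256, (3.16)–(3.25) pp.268–270, §3 p.279; Balaban1987RG1, (0.14)–(0.17) pp.254–255, (0.20) p.256, Thm 2 p.259, Thm 3 p.264, (1.20)–(1.22) p.264, §1 pp.263–264; Balaban1985RegularSpaces, Prop. 7 (1.145) p.100, Thm 8 (1.146) p.101 (bookkeeping); Balaban1987RG1, Thm 3 p.264, (2.1)–(2.3) p.265, (2.9)–(2.10) pp.266–267; Balaban1985Variational, Thm 1 (6), (8)–(10) p.279 and (181) p.307; Balaban1985Averaging, Prop. 2 (53) p.26] -/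
theorem N24_stabilityBRunRowsR13SepCoPHV_consequent_of_cofinalBetaSocketZBV23_of_childrenSplitSlot8DoorPinnedN09Thm3InputsN11SupplierRowsThm1AEPos_atGaussPinPrintedZB_pinY (Slot8 : (θ₃ : Stage3Params) → ResidB8 θ₃ → Prop) (ε : ℝ) (hεz : 0 < ε)
    (Efl : ℕ → ℝ → ℝ → ℝ → ℝ → ℝ → ℝ → ℝ → B12.RunParams → ℕ → ℝ)
    (h05F : ∀ {j : ℕ} {γ ε₀ ε₂₉ B₃ B₃' a₀ a₁ : ℝ} (hγ₀ : 0 < γ) (hγh : γ ≤ 1 / 2) (hε : 0 < ε₀) (hε' : 0 < ε₂₉) (hB : 0 ≤ B₃) (hB' : 0 ≤ B₃') (ha₀ : 0 < a₀) (ha₁ : 0 < a₁) (ha₀ρ : a₀ ≤ 1 / (109824 * (F.L : ℝ) ^ 2)) (hε₀ρ : ε₀ = a₀) {bl β' : ℝ} (hbox : BetaLowerH bl γ (betaOfRecord₁₃ F 2 (theta13OfThm1CCMWZB F 2 j γ a₀ ε₀ ε₂₉ B₃ B₃' a₀ a₁ (Efl j γ ε₀ ε₂₉ B₃ B₃' a₀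 a₁) (fun p i => Real.log (B16ZLower.zNorm (SU 2) (gOfRecord₁₃ F 2 (theta13OfThm1CCMWZB F 2 j γ a₀ ε₀ ε₂₉ B₃ B₃' a₀ a₁ (fun _ _ => 0) (fun _ _ => 0)) p i ^ 2) ε))))) (hbox' : BetaUpperH β' γ (betaOfRecord₁₃ F 2 (theta13OfThm1CCMWZB F 2 j γ a₀ ε₀ ε₂₉ B₃ B₃' a₀ a₁ (Efl j γ ε₀ ε₂₉ B₃ B₃' a₀ a₁) (fun p i => Real.log (B16ZLower.zNorm (SU 2) (gOfRecord₁₃ F 2 (theta13OfThm1CCMWZB F 2 j γ a₀ ε₀ ε₂₉ B₃ B₃' a₀ a₁ (fun _ _ => 0) (fun _ _ => 0)) p i ^ 2) ε))))) (hl : -bl * γ ^ 2 ≤ 3) (hβ' : β' * γ ^ 2 ≤ 3 / 4),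
      ∃ lam8 : ResidB8 (theta13OfThm1CCMWZB F 2 j γ a₀ ε₀ ε₂₉ B₃ B₃' a₀ a₁ (Efl j γ ε₀ ε₂₉ B₃ B₃' a₀ a₁) (fun p i => Real.log (B16ZLower.zNorm (SU 2) (gOfRecord₁₃ F 2 (theta13OfThm1CCMWZB F 2 j γ a₀ ε₀ ε₂₉ B₃ B₃' a₀ a₁ (fun _ _ => 0) (fun _ _ => 0)) p i ^ 2) ε))).toStage3Params, Slot8 (theta13OfThm1CCMWZB F 2 j γ a₀ ε₀ ε₂₉ B₃ B₃' a₀ a₁ (Efl j γ ε₀ ε₂₉ B₃ B₃' a₀ a₁) (fun p i => Real.log (B16ZLower.zNorm (SU 2) (gOfRecord₁₃ F 2 (theta13OfThm1CCMWZB F 2 j γ a₀ ε₀ ε₂₉ B₃ B₃' a₀ a₁ (fun _ _ => 0) (fun _ _ => 0)) p i ^ 2) ε))).toStage3Params lam8)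
    (h06F : ∀ {j : ℕ} {γ ε₀ ε₂₉ B₃ B₃' a₀ a₁ : ℝ} (hγ₀ : 0 < γ) (hγh : γ ≤ 1 / 2) (hε : 0 < ε₀) (hε' : 0 < ε₂₉) (hB : 0 ≤ B₃) (hB' : 0 ≤ B₃') (ha₀ : 0 < a₀) (ha₁ : 0 < a₁) (ha₀ρ : a₀ ≤ 1 / (109824 * (F.L : ℝ) ^ 2)) (hε₀ρ : ε₀ = a₀) {bl β' : ℝ} (hbox : BetaLowerH bl γ (betaOfRecord₁₃ F 2 (theta13OfThm1CCMWZB F 2 j γ a₀ ε₀ ε₂₉ B₃ B₃' a₀ a₁ (Efl j γ ε₀ ε₂₉ B₃ B₃' a₀ a₁) (fun p i => Real.log (B16ZLower.zNorm (SU 2) (gOfRecord₁₃ F 2 (theta13OfThm1CCMWZB F 2 j γ a₀ ε₀ ε₂₉ B₃ B₃' a₀ a₁ (fun _ _ => 0) (fun _ _ => 0)) p i ^ 2) ε))))) (hbox' : BetaUpperH β' γ (betaOfRecord₁₃ F 2 (theta13OfThm1CCMWZB F 2 j γ a₀ ε₀ ε₂₉ B₃ B₃' a₀ a₁ (Efl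 j γ ε₀ ε₂₉ B₃ B₃' a₀ a₁) (fun p i => Real.log (B16ZLower.zNorm (SU 2) (gOfRecord₁₃ F 2 (theta13OfThm1CCMWZB F 2 j γ a₀ ε₀ ε₂₉ B₃ B₃' a₀ a₁ (fun _ _ => 0) (fun _ _ => 0)) p i ^ 2) ε))))) (hl : -bl * γ ^ 2 ≤ 3) (hβ' : β' * γ ^ 2 ≤ 3 / 4),
      ∃ Y₀ : PrintedCarriers9X, B9LeafX Y₀)
    (h07 : ∃ ζ : ResidZ F 2, B11Leaf (Z11OfRecord F 2 ζ))
    (h08 : PrintedUV3V 2 F.L)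
    (h09F : ∀ {j : ℕ} {γ ε₀ ε₂₉ B₃ B₃' a₀ a₁ : ℝ} (hγ₀ : 0 < γ) (hγh : γ ≤ 1 / 2) (hε : 0 < ε₀) (hε' : 0 < ε₂₉) (hB : 0 ≤ B₃) (hB' : 0 ≤ B₃') (ha₀ : 0 < a₀) (ha₁ : 0 < a₁) (ha₀ρ : a₀ ≤ 1 / (109824 * (F.L : ℝ) ^ 2)) (hε₀ρ : ε₀ = a₀) {bl β' : ℝ} (hbox : BetaLowerH bl γ (betaOfRecord₁₃ F 2 (theta13OfThm1CCMWZB F 2 j γ a₀ ε₀ ε₂₉ B₃ B₃' a₀ a₁ (Efl j γ ε₀ ε₂₉ B₃ B₃' a₀ a₁) (fun p i => Real.log (B16ZLower.zNorm (SU 2) (gOfRecord₁₃ F 2 (theta13OfThm1CCMWZB F 2 j γ a₀ ε₀ ε₂₉ B₃ B₃' a₀ a₁ (fun _ _ => 0) (fun _ _ => 0)) p i ^ 2) ε))))) (hbox' : BetaUpperH β' γ (betaOfRecord₁₃ F 2 (theta13OfThm1CCMWZB F 2 j γ a₀ ε₀ ε₂₉ B₃ B₃' a₀ a₁ (Efl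 j γ ε₀ ε₂₉ B₃ B₃' a₀ a₁) (fun p i => Real.log (B16ZLower.zNorm (SU 2) (gOfRecord₁₃ F 2 (theta13OfThm1CCMWZB F 2 j γ a₀ ε₀ ε₂₉ B₃ B₃' a₀ a₁ (fun _ _ => 0) (fun _ _ => 0)) p i ^ 2) ε))))) (hl : -bl * γ ^ 2 ≤ 3) (hβ' : β' * γ ^ 2 ≤ 3 / 4),
      ∃ lam12 : ResidB12 F 2 (theta13OfThm1CCMWZB F 2 j γ a₀ ε₀ ε₂₉ B₃ B₃' a₀ a₁ (Efl j γ ε₀ ε₂₉ B₃ B₃' a₀ a₁) (fun p i => Real.log (B16ZLower.zNorm (SU 2) (gOfRecord₁₃ F 2 (theta13OfThm1CCMWZB F 2 j γ a₀ ε₀ ε₂₉ B₃ B₃' a₀ a₁ (fun _ _ => 0) (fun _ _ => 0)) p i ^ 2) ε))).τ9.M,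
      ∀ P : B12.RunParams, B12Sec2to5.Lemma4Printed (F12OfRecord₁₂ F 2 (theta13OfThm1CCMWZB F 2 j γ a₀ ε₀ ε₂₉ B₃ B₃' a₀ a₁ (Efl j γ ε₀ ε₂₉ B₃ B₃' a₀ a₁) (fun p i => Real.log (B16ZLower.zNorm (SU 2) (gOfRecord₁₃ F 2 (theta13OfThm1CCMWZB F 2 j γ a₀ ε₀ ε₂₉ B₃ B₃' a₀ a₁ (fun _ _ => 0) (fun _ _ => 0)) p i ^ 2) ε))).toStage12Params lam12 P) (lam12 P).consts)
    (hN09TF : ∀ {j : ℕ} {γ ε₀ ε₂₉ B₃ B₃' a₀ a₁ : ℝ} (hγ₀ : 0 < γ) (hγh : γ ≤ 1 / 2) (hε : 0 < ε₀) (hε' : 0 < ε₂₉) (hB : 0 ≤ B₃) (hB' : 0 ≤ B₃') (ha₀ : 0 < a₀) (ha₁ : 0 < a₁) (ha₀ρ : a₀ ≤ 1 / (109824 * (F.L : ℝ) ^ 2)) (hε₀ρ : ε₀ = a₀) {bl β' : ℝ} (hbox : BetaLowerH bl γ (betaOfRecord₁₃ F 2 (theta13OfThm1CCMWZB F 2 j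 γ a₀ ε₀ ε₂₉ B₃ B₃' a₀ a₁ (Efl j γ ε₀ ε₂₉ B₃ B₃' a₀ a₁) (fun p i => Real.log (B16ZLower.zNorm (SU 2) (gOfRecord₁₃ F 2 (theta13OfThm1CCMWZB F 2 j γ a₀ ε₀ ε₂₉ B₃ B₃' a₀ a₁ (fun _ _ => 0) (fun _ _ => 0)) p i ^ 2) ε))))) (hbox' : BetaUpperH β' γ (betaOfRecord₁₃ F 2 (theta13OfThm1CCMWZB F 2 j γ a₀ ε₀ ε₂₉ B₃ B₃' a₀ a₁ (Efl j γ ε₀ ε₂₉ B₃ B₃' a₀ a₁) (fun p i => Real.log (B16ZLower.zNorm (SU 2) (gOfRecord₁₃ F 2 (theta13OfThm1CCMWZB F 2 j γ a₀ ε₀ ε₂₉ B₃ B₃' a₀ a₁ (fun _ _ => 0) (fun _ _ => 0)) p i ^ 2) ε))))) (hl : -bl * γ ^ 2 ≤ 3) (hβ' : β' * γ ^ 2 ≤ 3 / 4),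
      ∃ cd : (P : B12.RunParams) → (i : ℕ) → ContourData (F.P P.K) i (SU 2),
        (∀ (P : B12.RunParams) (k : ℕ), k ≤ P.K → ∀ V ∈ domAltOfRecord F 2 (numerics7OfThm1CCM F.L j ε₀ B₃ B₃' a₀ a₁) P.K k, Uk F 2 P.K k a₀ V ∈ bgReg F 2 P.K k a₀) ∧
        (∀ (P : B12.RunParams), ∀ i < P.K, ∀ W ∈ domAltOfRecord F 2 (numerics7OfThm1CCM F.L j ε₀ B₃ B₃' a₀ a₁) P.K (i + 1), AxialGauge (cd P i) (critCfgOfRecord F 2 (numerics7OfThm1CCM F.L j ε₀ B₃ B₃' a₀ a₁) P.K i W)) ∧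
        (∀ (P : B12.RunParams) (k : ℕ), k ≤ P.K → ∀ V ∈ domAltOfRecord F 2 (numerics7OfThm1CCM F.L j ε₀ B₃ B₃' a₀ a₁) P.K k, ∀ i < k, AxialGauge (cd P i) (Averaging.iter (avOfRecord F 2 P.K) i (Uk F 2 P.K k a₀ V))) ∧
        (∀ (P : B12.RunParams) (i : ℕ), i + 1 < P.K → ∀ U : GaugeField (F.P P.K) (i + 1) (SU 2), (avOfRecord F 2 P.K (i + 1)).avg U ∈ domAltOfRecord F 2 (numerics7OfThm1CCM F.L j ε₀ B₃ B₃' a₀ a₁) P.K (i + 2) →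
          U ∉ regSetOfRecord F 2 P.K i (betaInputOfRecord F 2 (TβOfRecord₁₃ F 2) (chiβOfRecord₁₃ F 2 (theta13OfThm1CCMWZB F 2 j γ a₀ ε₀ ε₂₉ B₃ B₃' a₀ a₁ (Efl j γ ε₀ ε₂₉ B₃ B₃' a₀ a₁) (fun p i => Real.log (B16ZLower.zNorm (SU 2) (gOfRecord₁₃ F 2 (theta13OfThm1CCMWZB F 2 j γ a₀ ε₀ ε₂₉ B₃ B₃' a₀ a₁ (fun _ _ => 0) (fun _ _ => 0)) p i ^ 2) ε)))) P.K (gOfRecord₁₃ F 2 (theta13OfThm1CCMWZB F 2 j γ a₀ ε₀ ε₂₉ B₃ B₃' a₀ a₁ (Efl j γ ε₀ ε₂₉ B₃ B₃' a₀ a₁) (fun p i => Real.log (B16ZLower.zNorm (SU 2) (gOfRecord₁₃ F 2 (theta13OfThm1CCMWZB F 2 j γ a₀ ε₀ ε₂₉ B₃ B₃' a₀ a₁ (fun _ _ => 0) (fun _ _ => 0)) p i ^ 2) ε))) P) i) ∩ domAltOfRecord F 2 (numerics7OfThm1CCM F.L j ε₀ B₃ B₃' a₀ a₁) P.K (i +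 1) →
            chiβOfRecord₁₃ F 2 (theta13OfThm1CCMWZB F 2 j γ a₀ ε₀ ε₂₉ B₃ B₃' a₀ a₁ (Efl j γ ε₀ ε₂₉ B₃ B₃' a₀ a₁) (fun p i => Real.log (B16ZLower.zNorm (SU 2) (gOfRecord₁₃ F 2 (theta13OfThm1CCMWZB F 2 j γ a₀ ε₀ ε₂₉ B₃ B₃' a₀ a₁ (fun _ _ => 0) (fun _ _ => 0)) p i ^ 2) ε))) P.K (gOfRecord₁₃ F 2 (theta13OfThm1CCMWZB F 2 j γ a₀ ε₀ ε₂₉ B₃ B₃' a₀ a₁ (Efl j γ ε₀ ε₂₉ B₃ B₃' a₀ a₁) (fun p i => Real.log (B16ZLower.zNorm (SU 2) (gOfRecord₁₃ F 2 (theta13OfThm1CCMWZB F 2 j γ a₀ ε₀ ε₂₉ B₃ B₃' a₀ a₁ (fun _ _ => 0) (fun _ _ => 0)) p i ^ 2) ε))) P) (i + 1) U = 0) ∧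
        (∀ (P : B12.RunParams), ∀ i < P.K, MeasureTheory.Integrable (betaInputOfRecord F 2 (TβOfRecord₁₃ F 2) (chiβOfRecord₁₃ F 2 (theta13OfThm1CCMWZB F 2 j γ a₀ ε₀ ε₂₉ B₃ B₃' a₀ a₁ (Efl j γ ε₀ ε₂₉ B₃ B₃' a₀ a₁) (fun p i => Real.log (B16ZLower.zNorm (SU 2) (gOfRecord₁₃ F 2 (theta13OfThm1CCMWZB F 2 j γ a₀ ε₀ ε₂₉ B₃ B₃' a₀ a₁ (fun _ _ => 0) (fun _ _ => 0)) p i ^ 2) ε)))) P.K (gOfRecord₁₃ F 2 (theta13OfThm1CCMWZB F 2 j γ a₀ ε₀ ε₂₉ B₃ B₃' a₀ a₁ (Efl j γ ε₀ ε₂₉ B₃ B₃' a₀ a₁) (fun p i => Real.log (B16ZLower.zNorm (SU 2) (gOfRecord₁₃ F 2 (theta13OfThm1CCMWZB F 2 j γ a₀ ε₀ ε₂₉ B₃ B₃' a₀ a₁ (fun _ _ => 0) (fun _ _ => 0)) p i ^ 2) ε))) P) i) (fieldMeasure (F.P P.K) i (SU 2))) ∧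
        (∀ (P : B12.RunParams) (k : ℕ), k ≤ P.K → ∀ V ∈ domAltOfRecord F 2 (numerics7OfThm1CCM F.L j ε₀ B₃ B₃' a₀ a₁) P.K k, UkExists F 2 P.K k a₀ V ∧ UniqueUkOrbit F 2 P.K k a₀ V) ∧
        (∀ (P : B12.RunParams) (k : ℕ), k ≤ P.K → HRestrict F 2 a₀ P.K k (domAltOfRecord F 2 (numerics7OfThm1CCM F.L j ε₀ B₃ B₃' a₀ a₁) P.K k)) ∧
        (∀ (P : B12.RunParams) (k : ℕ), k ≤ P.K → ∀ V ∈ domAltOfRecord F 2 (numerics7OfThm1CCM F.L j ε₀ B₃ B₃' a₀ a₁) P.K k, ∀ i < k, UniqueUkOrbit F 2 P.K (i + 1) a₀ (Averaging.iter (avOfRecord F 2 P.K) (i + 1) (Uk F 2 P.K k a₀ V))))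
    (h10F : ∀ {j : ℕ} {γ ε₀ ε₂₉ B₃ B₃' a₀ a₁ : ℝ} (hγ₀ : 0 < γ) (hγh : γ ≤ 1 / 2) (hε : 0 < ε₀) (hε' : 0 < ε₂₉) (hB : 0 ≤ B₃) (hB' : 0 ≤ B₃') (ha₀ : 0 < a₀) (ha₁ : 0 < a₁) (ha₀ρ : a₀ ≤ 1 / (109824 * (F.L : ℝ) ^ 2)) (hε₀ρ : ε₀ = a₀) {bl β' : ℝ} (hbox : BetaLowerH bl γ (betaOfRecord₁₃ F 2 (theta13OfThm1CCMWZB F 2 j γ a₀ ε₀ ε₂₉ B₃ B₃' a₀ a₁ (Efl j γ ε₀ ε₂₉ B₃ B₃' a₀ a₁) (fun p i => Real.log (B16ZLower.zNorm (SU 2) (gOfRecord₁₃ F 2 (theta13OfThm1CCMWZB F 2 j γ a₀ ε₀ ε₂₉ B₃ B₃' a₀ a₁ (fun _ _ => 0) (fun _ _ => 0)) p i ^ 2) ε))))) (hbox' : BetaUpperH β' γ (betaOfRecord₁₃ F 2 (theta13OfThm1CCMWZB F 2 j γ a₀ ε₀ ε₂₉ B₃ B₃' a₀ a₁ (Efl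 j γ ε₀ ε₂₉ B₃ B₃' a₀ a₁) (fun p i => Real.log (B16ZLower.zNorm (SU 2) (gOfRecord₁₃ F 2 (theta13OfThm1CCMWZB F 2 j γ a₀ ε₀ ε₂₉ B₃ B₃' a₀ a₁ (fun _ _ => 0) (fun _ _ => 0)) p i ^ 2) ε))))) (hl : -bl * γ ^ 2 ≤ 3) (hβ' : β' * γ ^ 2 ≤ 3 / 4),
      ∃ lam13 : B12.RunParams → ResidB13 (theta13OfThm1CCMWZB F 2 j γ a₀ ε₀ ε₂₉ B₃ B₃' a₀ a₁ (Efl j γ ε₀ ε₂₉ B₃ B₃' a₀ a₁) (fun p i => Real.log (B16ZLower.zNorm (SU 2) (gOfRecord₁₃ F 2 (theta13OfThm1CCMWZB F 2 j γ a₀ ε₀ ε₂₉ B₃ B₃' a₀ a₁ (fun _ _ => 0) (fun _ _ => 0)) p i ^ 2) ε))).toStage3Params,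
      ∀ P : B12.RunParams, B13LeafOfRecord (theta13OfThm1CCMWZB F 2 j γ a₀ ε₀ ε₂₉ B₃ B₃' a₀ a₁ (Efl j γ ε₀ ε₂₉ B₃ B₃' a₀ a₁) (fun p i => Real.log (B16ZLower.zNorm (SU 2) (gOfRecord₁₃ F 2 (theta13OfThm1CCMWZB F 2 j γ a₀ ε₀ ε₂₉ B₃ B₃' a₀ a₁ (fun _ _ => 0) (fun _ _ => 0)) p i ^ 2) ε))).toStage3Params (lam13 P))
    (h11N : ∀ {j : ℕ} {γ ε₀ ε₂₉ B₃ B₃' a₀ a₁ : ℝ} (hγ₀ : 0 < γ) (hγh : γ ≤ 1 / 2) (hε : 0 < ε₀) (hε' : 0 < ε₂₉) (hB : 0 ≤ B₃) (hB' : 0 ≤ B₃') (ha₀ : 0 < a₀) (ha₁ : 0 < a₁) (ha₀ρ : a₀ ≤ 1 / (109824 * (F.L : ℝ) ^ 2)) (hε₀ρ : ε₀ = a₀) {bl β' : ℝ} (hbox : BetaLowerH bl γ (betaOfRecord₁₃ F 2 (theta13OfThm1CCMWZB F 2 j γ a₀ ε₀ ε₂₉ B₃ B₃' a₀ a₁ (Efl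 j γ ε₀ ε₂₉ B₃ B₃' a₀ a₁) (fun p i => Real.log (B16ZLower.zNorm (SU 2) (gOfRecord₁₃ F 2 (theta13OfThm1CCMWZB F 2 j γ a₀ ε₀ ε₂₉ B₃ B₃' a₀ a₁ (fun _ _ => 0) (fun _ _ => 0)) p i ^ 2) ε))))) (hbox' : BetaUpperH β' γ (betaOfRecord₁₃ F 2 (theta13OfThm1CCMWZB F 2 j γ a₀ ε₀ ε₂₉ B₃ B₃' a₀ a₁ (Efl j γ ε₀ ε₂₉ B₃ B₃' a₀ a₁) (fun p i => Real.log (B16ZLower.zNorm (SU 2) (gOfRecord₁₃ F 2 (theta13OfThm1CCMWZB F 2 j γ a₀ ε₀ ε₂₉ B₃ B₃' a₀ a₁ (fun _ _ => 0) (fun _ _ => 0)) p i ^ 2) ε))))) (hl : -bl * γ ^ 2 ≤ 3) (hβ' : β' * γ ^ 2 ≤ 3 / 4),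
      ∃ σ : (P : B12.RunParams) → Sect3Supplier (gaussPinH (Stage13HParams.ofHistoryBlind F 2 ⟨theta13OfThm1CCMWZB F 2 j γ a₀ ε₀ ε₂₉ B₃ B₃' a₀ a₁ (Efl j γ ε₀ ε₂₉ B₃ B₃' a₀ a₁) (fun p i => Real.log (B16ZLower.zNorm (SU 2) (gOfRecord₁₃ F 2 (theta13OfThm1CCMWZB F 2 j γ a₀ ε₀ ε₂₉ B₃ B₃' a₀ a₁ (fun _ _ => 0) (fun _ _ => 0)) p i ^ 2) ε)), ZrOfRecord₁₃ F 2 (theta13OfThm1CCMWZB F 2 j γ a₀ ε₀ ε₂₉ B₃ B₃' a₀ a₁ (Efl j γ ε₀ ε₂₉ B₃ B₃' a₀ a₁) (fun p i => Real.log (B16ZLower.zNorm (SU 2) (gOfRecord₁₃ F 2 (theta13OfThm1CCMWZB F 2 j γ a₀ ε₀ ε₂₉ B₃ B₃' a₀ a₁ (fun _ _ => 0) (fun _ _ => 0)) p i ^ 2) ε)))⟩)) P,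
        (∀ P : B12.RunParams, Step.InInterval γ P.K (gOfRecord₁₃ F 2 (theta13OfThm1CCMWZB F 2 j γ a₀ ε₀ ε₂₉ B₃ B₃' a₀ a₁ (Efl j γ ε₀ ε₂₉ B₃ B₃' a₀ a₁) (fun p i => Real.log (B16ZLower.zNorm (SU 2) (gOfRecord₁₃ F 2 (theta13OfThm1CCMWZB F 2 j γ a₀ ε₀ ε₂₉ B₃ B₃' a₀ a₁ (fun _ _ => 0) (fun _ _ => 0)) p i ^ 2) ε))) P) → SupplierObligations (gaussPinH (Stage13HParams.ofHistoryBlind F 2 ⟨theta13OfThm1CCMWZB F 2 j γ a₀ ε₀ ε₂₉ B₃ B₃' a₀ a₁ (Efl j γ ε₀ ε₂₉ B₃ B₃' a₀ a₁) (fun p i => Real.log (B16ZLower.zNorm (SU 2) (gOfRecord₁₃ F 2 (theta13OfThm1CCMWZB F 2 j γ a₀ ε₀ ε₂₉ B₃ B₃' a₀ a₁ (fun _ _ => 0) (fun _ _ => 0)) p i ^ 2) ε)), ZrOfRecord₁₃ F 2 (theta13OfThm1CCMWZB F 2 j γ a₀ ε₀ ε₂₉ B₃ B₃' a₀ a₁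 (Efl j γ ε₀ ε₂₉ B₃ B₃' a₀ a₁) (fun p i => Real.log (B16ZLower.zNorm (SU 2) (gOfRecord₁₃ F 2 (theta13OfThm1CCMWZB F 2 j γ a₀ ε₀ ε₂₉ B₃ B₃' a₀ a₁ (fun _ _ => 0) (fun _ _ => 0)) p i ^ 2) ε)))⟩)) P (σ P)) ∧
        (∀ P : B12.RunParams, Step.InInterval γ P.K (gOfRecord₁₃ F 2 (theta13OfThm1CCMWZB F 2 j γ a₀ ε₀ ε₂₉ B₃ B₃' a₀ a₁ (Efl j γ ε₀ ε₂₉ B₃ B₃' a₀ a₁) (fun p i => Real.log (B16ZLower.zNorm (SU 2) (gOfRecord₁₃ F 2 (theta13OfThm1CCMWZB F 2 j γ a₀ ε₀ ε₂₉ B₃ B₃' a₀ a₁ (fun _ _ => 0) (fun _ _ => 0)) p i ^ 2) ε))) P) → OperandRowsAlongChain (gaussPinH (Stage13HParams.ofHistoryBlind F 2 ⟨theta13OfThm1CCMWZB F 2 j γ a₀ ε₀ ε₂₉ B₃ B₃' a₀ a₁ (Efl j γ ε₀ ε₂₉ B₃ B₃' a₀ a₁) (fun p i => Real.log (B16ZLower.zNorm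 (SU 2) (gOfRecord₁₃ F 2 (theta13OfThm1CCMWZB F 2 j γ a₀ ε₀ ε₂₉ B₃ B₃' a₀ a₁ (fun _ _ => 0) (fun _ _ => 0)) p i ^ 2) ε)), ZrOfRecord₁₃ F 2 (theta13OfThm1CCMWZB F 2 j γ a₀ ε₀ ε₂₉ B₃ B₃' a₀ a₁ (Efl j γ ε₀ ε₂₉ B₃ B₃' a₀ a₁) (fun p i => Real.log (B16ZLower.zNorm (SU 2) (gOfRecord₁₃ F 2 (theta13OfThm1CCMWZB F 2 j γ a₀ ε₀ ε₂₉ B₃ B₃' a₀ a₁ (fun _ _ => 0) (fun _ _ => 0)) p i ^ 2) ε)))⟩)) P (σ P)))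
    (hEfl : ∀ (j : ℕ) (γ ε₀ ε₂₉ B₃ B₃' a₀ a₁ : ℝ), ∃ CE : ℝ, 0 ≤ CE ∧ ∀ (P : B12.RunParams) (i : ℕ), i < P.K → |Efl j γ ε₀ ε₂₉ B₃ B₃' a₀ a₁ P i| ≤ CE * sitesCard (F.P P.K) (i + 1))
    (h13posF : ∀ {j : ℕ} {γ ε₀ ε₂₉ B₃ B₃' a₀ a₁ : ℝ} (hγ₀ : 0 < γ) (hγh : γ ≤ 1 / 2) (hε : 0 < ε₀) (hε' : 0 < ε₂₉) (hB : 0 ≤ B₃) (hB' : 0 ≤ B₃') (ha₀ : 0 < a₀) (ha₁ : 0 < a₁) (ha₀ρ : a₀ ≤ 1 / (109824 * (F.L : ℝ) ^ 2)) (hε₀ρ : ε₀ = a₀) {bl β' : ℝ} (hbox : BetaLowerH bl γ (betaOfRecord₁₃ F 2 (theta13OfThm1CCMWZB F 2 j γ a₀ ε₀ ε₂₉ B₃ B₃' a₀ a₁ (Efl j γ ε₀ ε₂₉ B₃ B₃' a₀ a₁) (fun p i => Real.log (B16ZLower.zNorm (SU 2) (gOfRecord₁₃ F 2 (theta13OfThm1CCMWZB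 F 2 j γ a₀ ε₀ ε₂₉ B₃ B₃' a₀ a₁ (fun _ _ => 0) (fun _ _ => 0)) p i ^ 2) ε))))) (hbox' : BetaUpperH β' γ (betaOfRecord₁₃ F 2 (theta13OfThm1CCMWZB F 2 j γ a₀ ε₀ ε₂₉ B₃ B₃' a₀ a₁ (Efl j γ ε₀ ε₂₉ B₃ B₃' a₀ a₁) (fun p i => Real.log (B16ZLower.zNorm (SU 2) (gOfRecord₁₃ F 2 (theta13OfThm1CCMWZB F 2 j γ a₀ ε₀ ε₂₉ B₃ B₃' a₀ a₁ (fun _ _ => 0) (fun _ _ => 0)) p i ^ 2) ε))))) (hl : -bl * γ ^ 2 ≤ 3) (hβ' : β' * γ ^ 2 ≤ 3 / 4)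
      (hP : (gaussPinH (Stage13HParams.ofHistoryBlind F 2 ⟨theta13OfThm1CCMWZB F 2 j γ a₀ ε₀ ε₂₉ B₃ B₃' a₀ a₁ (Efl j γ ε₀ ε₂₉ B₃ B₃' a₀ a₁) (fun p i => Real.log (B16ZLower.zNorm (SU 2) (gOfRecord₁₃ F 2 (theta13OfThm1CCMWZB F 2 j γ a₀ ε₀ ε₂₉ B₃ B₃' a₀ a₁ (fun _ _ => 0) (fun _ _ => 0)) p i ^ 2) ε)), ZrOfRecord₁₃ F 2 (theta13OfThm1CCMWZB F 2 j γ a₀ ε₀ ε₂₉ B₃ B₃' a₀ a₁ (Efl j γ ε₀ ε₂₉ B₃ B₃' a₀ a₁) (fun p i => Real.log (B16ZLower.zNorm (SU 2) (gOfRecord₁₃ F 2 (theta13OfThm1CCMWZB F 2 j γ a₀ ε₀ ε₂₉ B₃ B₃' a₀ a₁ (fun _ _ => 0) (fun _ _ => 0)) p i ^ 2) ε)))⟩)).Provisos₁₃SepCoPH F 2),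
      ∃ γ₁₃ : ℝ, 0 < γ₁₃ ∧ ∃ em ep : ℝ → ℝ,
        (∀ P : B12.RunParams, ((datumOfRecord₁₃SepCoPH F 2 (gaussPinH (Stage13HParams.ofHistoryBlind F 2 ⟨theta13OfThm1CCMWZB F 2 j γ a₀ ε₀ ε₂₉ B₃ B₃' a₀ a₁ (Efl j γ ε₀ ε₂₉ B₃ B₃' a₀ a₁) (fun p i => Real.log (B16ZLower.zNorm (SU 2) (gOfRecord₁₃ F 2 (theta13OfThm1CCMWZB F 2 j γ a₀ ε₀ ε₂₉ B₃ B₃' a₀ a₁ (fun _ _ => 0) (fun _ _ => 0)) p i ^ 2) ε)), ZrOfRecord₁₃ F 2 (theta13OfThm1CCMWZB F 2 j γ a₀ ε₀ ε₂₉ B₃ B₃' a₀ a₁ (Efl j γ ε₀ ε₂₉ B₃ B₃' a₀ a₁) (fun p i => Real.log (B16ZLower.zNorm (SU 2) (gOfRecord₁₃ F 2 (theta13OfThm1CCMWZB F 2 j γ a₀ ε₀ ε₂₉ B₃ B₃' a₀ a₁ (fun _ _ => 0) (fun _ _ => 0)) p i ^ 2) ε)))⟩)) hP).C P).flow.InInterval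 γ₁₃ P.K → ∀ k, k + 1 ≤ P.K → SLaw₁₃CoPH F 2 (gaussPinH (Stage13HParams.ofHistoryBlind F 2 ⟨theta13OfThm1CCMWZB F 2 j γ a₀ ε₀ ε₂₉ B₃ B₃' a₀ a₁ (Efl j γ ε₀ ε₂₉ B₃ B₃' a₀ a₁) (fun p i => Real.log (B16ZLower.zNorm (SU 2) (gOfRecord₁₃ F 2 (theta13OfThm1CCMWZB F 2 j γ a₀ ε₀ ε₂₉ B₃ B₃' a₀ a₁ (fun _ _ => 0) (fun _ _ => 0)) p i ^ 2) ε)), ZrOfRecord₁₃ F 2 (theta13OfThm1CCMWZB F 2 j γ a₀ ε₀ ε₂₉ B₃ B₃' a₀ a₁ (Efl j γ ε₀ ε₂₉ B₃ B₃' a₀ a₁) (fun p i => Real.log (B16ZLower.zNorm (SU 2) (gOfRecord₁₃ F 2 (theta13OfThm1CCMWZB F 2 j γ a₀ ε₀ ε₂₉ B₃ B₃' a₀ a₁ (fun _ _ => 0) (fun _ _ => 0)) p i ^ 2) ε)))⟩)) P (k + 1) →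
      ∀ᵐ U ∂(fieldMeasure (F.P P.K) (k + 1) (SU 2)),
        chiβOfRecord₁₃ F 2 (theta13OfThm1CCMWZB F 2 j γ a₀ ε₀ ε₂₉ B₃ B₃' a₀ a₁ (Efl j γ ε₀ ε₂₉ B₃ B₃' a₀ a₁) (fun p i => Real.log (B16ZLower.zNorm (SU 2) (gOfRecord₁₃ F 2 (theta13OfThm1CCMWZB F 2 j γ a₀ ε₀ ε₂₉ B₃ B₃' a₀ a₁ (fun _ _ => 0) (fun _ _ => 0)) p i ^ 2) ε))) P.K (gOfRecord₁₃ F 2 (theta13OfThm1CCMWZB F 2 j γ a₀ ε₀ ε₂₉ B₃ B₃' a₀ a₁ (Efl j γ ε₀ ε₂₉ B₃ B₃' a₀ a₁) (fun p i => Real.log (B16ZLower.zNorm (SU 2) (gOfRecord₁₃ F 2 (theta13OfThm1CCMWZB F 2 j γ a₀ ε₀ ε₂₉ B₃ B₃' a₀ a₁ (fun _ _ => 0) (fun _ _ => 0)) p i ^ 2) ε))) P) (k + 1) U *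
              Real.exp (-(1 / (gOfRecord₁₃ F 2 (theta13OfThm1CCMWZB F 2 j γ a₀ ε₀ ε₂₉ B₃ B₃' a₀ a₁ (Efl j γ ε₀ ε₂₉ B₃ B₃' a₀ a₁) (fun p i => Real.log (B16ZLower.zNorm (SU 2) (gOfRecord₁₃ F 2 (theta13OfThm1CCMWZB F 2 j γ a₀ ε₀ ε₂₉ B₃ B₃' a₀ a₁ (fun _ _ => 0) (fun _ _ => 0)) p i ^ 2) ε))) P (k + 1)) ^ 2 * wilsonBGOfRecord F 2 (theta13OfThm1CCMWZB F 2 j γ a₀ ε₀ ε₂₉ B₃ B₃' a₀ a₁ (Efl j γ ε₀ ε₂₉ B₃ B₃' a₀ a₁) (fun p i => Real.log (B16ZLower.zNorm (SU 2) (gOfRecord₁₃ F 2 (theta13OfThm1CCMWZB F 2 j γ a₀ ε₀ ε₂₉ B₃ B₃' a₀ a₁ (fun _ _ => 0) (fun _ _ => 0)) p i ^ 2) ε))).εbg P (k + 1) U)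
                - em (gOfRecord₁₃ F 2 (theta13OfThm1CCMWZB F 2 j γ a₀ ε₀ ε₂₉ B₃ B₃' a₀ a₁ (Efl j γ ε₀ ε₂₉ B₃ B₃' a₀ a₁) (fun p i => Real.log (B16ZLower.zNorm (SU 2) (gOfRecord₁₃ F 2 (theta13OfThm1CCMWZB F 2 j γ a₀ ε₀ ε₂₉ B₃ B₃' a₀ a₁ (fun _ _ => 0) (fun _ _ => 0)) p i ^ 2) ε))) P (k + 1)) * (Fintype.card (Site (F.P P.K) (k + 1)) : ℝ)) ≤ densOfRecord₁₃ F 2 (theta13OfThm1CCMWZB F 2 j γ a₀ ε₀ ε₂₉ B₃ B₃' a₀ a₁ (Efl j γ ε₀ ε₂₉ B₃ B₃' a₀ a₁) (fun p i => Real.log (B16ZLower.zNorm (SU 2) (gOfRecord₁₃ F 2 (theta13OfThm1CCMWZB F 2 j γ a₀ ε₀ ε₂₉ B₃ B₃' a₀ a₁ (fun _ _ => 0) (fun _ _ => 0)) p i ^ 2) ε))) P (k + 1) U ∧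
          densOfRecord₁₃ F 2 (theta13OfThm1CCMWZB F 2 j γ a₀ ε₀ ε₂₉ B₃ B₃' a₀ a₁ (Efl j γ ε₀ ε₂₉ B₃ B₃' a₀ a₁) (fun p i => Real.log (B16ZLower.zNorm (SU 2) (gOfRecord₁₃ F 2 (theta13OfThm1CCMWZB F 2 j γ a₀ ε₀ ε₂₉ B₃ B₃' a₀ a₁ (fun _ _ => 0) (fun _ _ => 0)) p i ^ 2) ε))) P (k + 1) U ≤ Real.exp (ep (gOfRecord₁₃ F 2 (theta13OfThm1CCMWZB F 2 j γ a₀ ε₀ ε₂₉ B₃ B₃' a₀ a₁ (Efl j γ ε₀ ε₂₉ B₃ B₃' a₀ a₁) (fun p i => Real.log (B16ZLower.zNorm (SU 2) (gOfRecord₁₃ F 2 (theta13OfThm1CCMWZB F 2 j γ a₀ ε₀ ε₂₉ B₃ B₃' a₀ a₁ (fun _ _ => 0) (fun _ _ => 0)) p i ^ 2) ε))) P (k + 1)) * (Fintype.card (Site (F.P P.K) (k + 1)) : ℝ))))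
    -- ★ THE COFINAL β-SOCKET (director-ym №402 (R) ∕ P3 g84 spec (R1)): K0⁷'s sign-free β-BOX AND NODE O's four RUN ROWS AT A RADIUS SUPPLIED BY THE PRODUCER — for every ceiling `a > 0` SOME
    -- `0 < a₀ ≤ a`, SOME member letters `(j, ε₀, B₃, B₃′, a₁, Efl, logz)`, level `γ₀`, threshold `ε₂₉`, bound `β′` with the abs box of β₁₃ at the doors' HALF-WINDOW Z3 member
    -- (= the body of `K0V23Stub3DoorSuppliers.K0BoxCofinalRadii` ✓p781725 at `F`, conjunct for conjunct) ∧ NODE O's rows (i) (iv) (C) at THAT β at SOME level `γ₁` (K1⁹'s own rows conjunct);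
    -- replaces engine v2's `h3` (the ∀-radius V23 stub text) AND `hrowsRF` (the ∀-door run rows): the socket bills the producer at ITS radius, not at every small radius
    (hβc : ∀ a : ℝ, 0 < a → ∃ a₀ : ℝ, 0 < a₀ ∧ a₀ ≤ a ∧
      ∃ (γ₀ ε₂₉ β' : ℝ) (j : ℕ) (ε₀ B₃ B₃' a₁ : ℝ) (Efl logz : B12.RunParams → ℕ → ℝ), 0 < γ₀ ∧ 0 < ε₂₉ ∧
        BetaLowerH (-β') γ₀ (betaOfRecord₁₃ F 2 (theta13OfThm1CCMWZB F 2 j (1 / 2) a₀ ε₀ ε₂₉ B₃ B₃' a₀ a₁ Efl logz)) ∧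
        BetaUpperH β' γ₀ (betaOfRecord₁₃ F 2 (theta13OfThm1CCMWZB F 2 j (1 / 2) a₀ ε₀ ε₂₉ B₃ B₃' a₀ a₁ Efl logz)) ∧
        ∃ (b : ℕ → ℝ) (r γ₁ M : ℝ), 0 < γ₁ ∧
          (∀ (n : ℕ) (gs : ℕ → ℝ), RGEqH n (betaOfRecord₁₃ F 2 (theta13OfThm1CCMWZB F 2 j (1 / 2) a₀ ε₀ ε₂₉ B₃ B₃' a₀ a₁ Efl logz)) gs → Step.InInterval γ₁ n gs → ∀ k, k ≤ n → |betaOfRecord₁₃ F 2 (theta13OfThm1CCMWZB F 2 j (1 / 2) a₀ ε₀ ε₂₉ B₃ B₃' a₀ a₁ Efl logz) k (prefixOf gs k) - b k| ≤ r) ∧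
          (∀ (n : ℕ) (gs : ℕ → ℝ), RGEqH n (betaOfRecord₁₃ F 2 (theta13OfThm1CCMWZB F 2 j (1 / 2) a₀ ε₀ ε₂₉ B₃ B₃' a₀ a₁ Efl logz)) gs → Step.InInterval γ₁ n gs → ∀ k, k ≤ n → -M ≤ ∑ i ∈ Finset.Ico k n, betaOfRecord₁₃ F 2 (theta13OfThm1CCMWZB F 2 j (1 / 2) a₀ ε₀ ε₂₉ B₃ B₃' a₀ a₁ Efl logz) i (prefixOf gs i)) ∧
          ∀ k : ℕ, ContinuousOn (fun x : ℝ => betaOfRecord₁₃ F 2 (theta13OfThm1CCMWZB F 2 j (1 / 2) a₀ ε₀ ε₂₉ B₃ B₃' a₀ a₁ Efl logz) k (clampPrefix (betaOfRecord₁₃ F 2 (theta13OfThm1CCMWZB F 2 j (1 / 2) a₀ ε₀ ε₂₉ B₃ B₃' a₀ a₁ Efl logz)) γ₁ k x))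
            {x : ℝ | 0 < x ∧ x ≤ γ₁ ∧ ∀ i, i ≤ k → 1 / γ₁ ^ 2 ≤ Y (betaOfRecord₁₃ F 2 (theta13OfThm1CCMWZB F 2 j (1 / 2) a₀ ε₀ ε₂₉ B₃ B₃' a₀ a₁ Efl logz)) γ₁ i x}) :
    ∃ (θ' : Stage13HParams F 2) (h' : θ'.Provisos₁₃SepCoPH F 2) (v' : Revision₁₃ F 2 θ' h'), (θ'.ZhUnity F 2 ∧ θ'.SlotsNondegenerate₁₃ F 2) ∧ θ'.Admissible F 2 ∧
      B16.EndStatementBPrinted (datumOfRecord₁₃SepCoPHV F 2 θ' h' v').C ∧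
      (∃ γ₁ : ℝ, 0 < γ₁ ∧ ∀ γ : ℝ, 0 < γ → γ ≤ γ₁ → ∃ P : B12.RunParams, 1 ≤ P.K ∧ ((datumOfRecord₁₃SepCoPHV F 2 θ' h' v').C P).flow.InInterval γ P.K) ∧
      ∃ (b : ℕ → ℝ) (r γ₀ M : ℝ), 0 < γ₀ ∧
        (∀ (n : ℕ) (gs : ℕ → ℝ), RGEqH n (betaOfRecord₁₃ F 2 θ'.toStage13Params) gs → Step.InInterval γ₀ n gs → ∀ k, k ≤ n → |betaOfRecord₁₃ F 2 θ'.toStage13Params k (prefixOf gs k) - b k| ≤ r) ∧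
        (∀ (n : ℕ) (gs : ℕ → ℝ), RGEqH n (betaOfRecord₁₃ F 2 θ'.toStage13Params) gs → Step.InInterval γ₀ n gs → ∀ k, k ≤ n → -M ≤ ∑ j ∈ Finset.Ico k n, betaOfRecord₁₃ F 2 θ'.toStage13Params j (prefixOf gs j)) ∧
        ∀ k : ℕ, ContinuousOn (fun x : ℝ => betaOfRecord₁₃ F 2 θ'.toStage13Params k (clampPrefix (betaOfRecord₁₃ F 2 θ'.toStage13Params) γ₀ k x))
          {x : ℝ | 0 < x ∧ x ≤ γ₀ ∧ ∀ j', j' ≤ k → 1 / γ₀ ^ 2 ≤ Y (betaOfRecord₁₃ F 2 θ'.toStage13Params) γ₀ j' x} := by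
  -- the door's two L-only [B7]-numerics rows need `8 ≤ L`; the engine's radius ceiling `a₀ ≤ 1/(109824·L²)` (edition «N09T2»)
  have hL8 : (8 : ℝ) ≤ (F.L : ℝ) := by
    have h1 := eight_le_L_stage3OfFamily F
    have h2 := stage3OfFamily_ℓ₆_succ F
    exact_mod_cast (show (8 : ℕ) ≤ F.L by omega)
  have hL2 : (0 : ℝ) < 109824 * (F.L : ℝ) ^ 2 := by positivity
  -- ★ THE RADIUS FROM THE PRODUCER (director-ym №402 (R) ∕ P3 g84 (R1)): stub 1ᴮ's ∃-radius `ā` (k0 `K0V23Stub3NonVacuity.exists_radius_antecedentsZB_inhabited_below`: below `ā` the ᴮ (8)-sentence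
  -- and (9)-token are jointly inhabited — stub 1ᴮ PROVED + 53′ + the (9)-supplier with [6] Prop. 6 printed) and the engine's ceiling `1∕(109824·L²)` are handed to the socket as `a := min ā (1∕(109824·L²))`;
  -- the socket returns SOME `0 < a₀ ≤ a` with the producer's member letters, `γ₀`, `ε₂₉`, `β′`, the abs box and NODE O's rows THERE
  obtain ⟨ā, hā, hinh⟩ := exists_radius_antecedentsZB_inhabited_below F
  obtain ⟨a₀, ha₀, ha₀le, γ₀, ε₂₉, β', j₁, ε₀₁, C₃, C₃', c₁', Efl₁, logz₁, hγ0, hε', hlow₁, hup₁, hrows₁⟩ :=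
    hβc (min ā (1 / (109824 * (F.L : ℝ) ^ 2))) (lt_min hā (one_div_pos.mpr hL2))
  have ha₀ρ : a₀ ≤ 1 / (109824 * (F.L : ℝ) ^ 2) := ha₀le.trans (min_le_right _ _)
  -- the K0 door AT THE PRODUCER's RADIUS: `(j, c′, c₀, c₁; B₃, B₉, a₁′)` with riders, signs, the ᴮ (8)-sentence `h15` and (9)-token `h9` under `A‴` at `(lamDatum F, dataSmall7LamTopOf F 2)`
  obtain ⟨j, c', c₀, c₁, B₃, B₉, a₁', hc', hc₀, hc₁, hB₃, hB9, ha₁', h15, h9⟩ := hinh a₀ ha₀ (ha₀le.trans (min_le_left _ _))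
  -- the producer's box RE-LETTERED to the door's letter-free half-window member (the census: β₁₃ at the half-window Z3 member reads `(F; a₀, ε₂₉)` only — `rfl`, k0's
  -- `K0V23Stub3Sockets.betaOfRecord₁₃_zbRegime_letterBlind` stated inline to stay off the Theses cone), then the window SHRUNK to `0 < γ ≤ ½` with the two letters (n07-w3's `windowLetters_of_absBoxH`)
  have census : betaOfRecord₁₃ F 2 (theta13OfThm1CCMWZB F 2 j (1 / 2) a₀ a₀ ε₂₉ B₃ B₉ a₀ a₁' (fun _ _ => 0) (fun _ _ => 0)) =
      betaOfRecord₁₃ F 2 (theta13OfThm1CCMWZB F 2 j₁ (1 / 2) a₀ ε₀₁ ε₂₉ C₃ C₃' a₀ c₁' Efl₁ logz₁) := rfl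
  have hlow₀ : BetaLowerH (-β') γ₀ (betaOfRecord₁₃ F 2 (theta13OfThm1CCMWZB F 2 j (1 / 2) a₀ a₀ ε₂₉ B₃ B₉ a₀ a₁' (fun _ _ => 0) (fun _ _ => 0))) := by
    rw [census]; exact hlow₁
  have hup₀ : BetaUpperH β' γ₀ (betaOfRecord₁₃ F 2 (theta13OfThm1CCMWZB F 2 j (1 / 2) a₀ a₀ ε₂₉ B₃ B₉ a₀ a₁' (fun _ _ => 0) (fun _ _ => 0))) := by
    rw [census]; exact hup₁
  obtain ⟨γ, hγpos, hγh, hl, hu, hlow', hup'⟩ := windowLetters_of_absBoxH hγ0 hlow₀ hup₀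
  have hL0 : (0 : ℝ) < (F.L : ℝ) := by exact_mod_cast lt_trans Nat.zero_lt_one F.hL.2
  have hBpos : (0 : ℝ) < B₃ := lt_of_lt_of_le (mul_pos two_pos (pow_pos hL0 2)) hB₃
  -- edition «N09T5»: the door's small-field threshold at the TOP of the window, `ε₀ := a₀` (an opaque letter pinned by `hε₀def`, fed to every per-door family's `hε₀ρ`)
  obtain ⟨ε₀, hε₀def⟩ : ∃ ε₀ : ℝ, ε₀ = a₀ := ⟨_, rfl⟩
  have hε : 0 < ε₀ := by rw [hε₀def]; exact ha₀
  have hbg₀ : ∀ P : B12.RunParams, 2 * a₀ ≤ ε₀ * ((F.P P.K).L : ℝ) ^ 2 := fun _ => by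
    have hL2' : (2 : ℝ) ≤ (F.L : ℝ) := by exact_mod_cast F.hL.2
    have hL4 : (4 : ℝ) ≤ (F.L : ℝ) ^ 2 := by nlinarith [hL2']
    rw [hε₀def]; show 2 * a₀ ≤ a₀ * (F.L : ℝ) ^ 2
    calc 2 * a₀ ≤ a₀ * 4 := by linarith [ha₀]
      _ ≤ a₀ * (F.L : ℝ) ^ 2 := mul_le_mul_of_nonneg_left hL4 ha₀.le
  -- the box at the WINDOW-EDITION letter-free member (node00's half-window transfer) and at the engine's member (β of the Z3 member is letter- and ε₀-blind by `rfl`)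
  have hloW : BetaLowerH (-β') γ (betaOfRecord₁₃ F 2 (theta13OfThm1CCMWZB F 2 j γ a₀ ε₀ ε₂₉ B₃ B₉ a₀ a₁' (fun _ _ => 0) (fun _ _ => 0))) := by
    rw [hε₀def]; exact betaLowerH_theta13OfThm1CCMWZB_of_half (Efl := fun _ _ => 0) (logz := fun _ _ => 0) hγh hlow'
  have hupW : BetaUpperH β' γ (betaOfRecord₁₃ F 2 (theta13OfThm1CCMWZB F 2 j γ a₀ ε₀ ε₂₉ B₃ B₉ a₀ a₁' (fun _ _ => 0) (fun _ _ => 0))) := by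
    rw [hε₀def]; exact betaUpperH_theta13OfThm1CCMWZB_of_half (Efl := fun _ _ => 0) (logz := fun _ _ => 0) hγh hup'
  have hloZ : BetaLowerH _ γ (betaOfRecord₁₃ F 2 (theta13OfThm1CCMWZB F 2 j γ a₀ ε₀ ε₂₉ B₃ B₉ a₀ a₁' (Efl j γ ε₀ ε₂₉ B₃ B₉ a₀ a₁') (fun p i => Real.log (B16ZLower.zNorm (SU 2) (gOfRecord₁₃ F 2 (theta13OfThm1CCMWZB F 2 j γ a₀ ε₀ ε₂₉ B₃ B₉ a₀ a₁' (fun _ _ => 0) (fun _ _ => 0)) p i ^ 2) ε)))) := hloW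
  have hupZ : BetaUpperH _ γ (betaOfRecord₁₃ F 2 (theta13OfThm1CCMWZB F 2 j γ a₀ ε₀ ε₂₉ B₃ B₉ a₀ a₁' (Efl j γ ε₀ ε₂₉ B₃ B₉ a₀ a₁') (fun p i => Real.log (B16ZLower.zNorm (SU 2) (gOfRecord₁₃ F 2 (theta13OfThm1CCMWZB F 2 j γ a₀ ε₀ ε₂₉ B₃ B₉ a₀ a₁' (fun _ _ => 0) (fun _ _ => 0)) p i ^ 2) ε)))) := hupW
  -- ★ NODE O's rows RE-LETTERED AND MOVED to the window-edition member (this seat's `K1RunRowsBoxCongr.runRows_theta13OfThm1CCMWZB_window_of_half`: the four rows read β on the boxes of their own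
  -- level only; the level lands at `min γ₁ γ`) — replaces engine v2's read of the ∀-door binder `hrowsRF` at this door
  have hrowsE : ∃ (b : ℕ → ℝ) (r γ₀ M : ℝ), 0 < γ₀ ∧
      (∀ (n : ℕ) (gs : ℕ → ℝ), RGEqH n (betaOfRecord₁₃ F 2 (theta13OfThm1CCMWZB F 2 j γ a₀ ε₀ ε₂₉ B₃ B₉ a₀ a₁' (Efl j γ ε₀ ε₂₉ B₃ B₉ a₀ a₁') (fun p i => Real.log (B16ZLower.zNorm (SU 2) (gOfRecord₁₃ F 2 (theta13OfThm1CCMWZB F 2 j γ a₀ ε₀ ε₂₉ B₃ B₉ a₀ a₁' (fun _ _ => 0) (fun _ _ => 0)) p i ^ 2) ε)))) gs → Step.InInterval γ₀ n gs → ∀ k, k ≤ n → |betaOfRecord₁₃ F 2 (theta13OfThm1CCMWZB F 2 j γ a₀ ε₀ ε₂₉ B₃ B₉ a₀ a₁' (Efl j γ ε₀ ε₂₉ B₃ B₉ a₀ a₁') (fun p i => Real.log (B16ZLower.zNorm (SU 2) (gOfRecord₁₃ F 2 (theta13OfThm1CCMWZB F 2 j γ a₀ ε₀ ε₂₉ B₃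 B₉ a₀ a₁' (fun _ _ => 0) (fun _ _ => 0)) p i ^ 2) ε))) k (prefixOf gs k) - b k| ≤ r) ∧
      (∀ (n : ℕ) (gs : ℕ → ℝ), RGEqH n (betaOfRecord₁₃ F 2 (theta13OfThm1CCMWZB F 2 j γ a₀ ε₀ ε₂₉ B₃ B₉ a₀ a₁' (Efl j γ ε₀ ε₂₉ B₃ B₉ a₀ a₁') (fun p i => Real.log (B16ZLower.zNorm (SU 2) (gOfRecord₁₃ F 2 (theta13OfThm1CCMWZB F 2 j γ a₀ ε₀ ε₂₉ B₃ B₉ a₀ a₁' (fun _ _ => 0) (fun _ _ => 0)) p i ^ 2) ε)))) gs → Step.InInterval γ₀ n gs → ∀ k, k ≤ n → -M ≤ ∑ i ∈ Finset.Ico k n, betaOfRecord₁₃ F 2 (theta13OfThm1CCMWZB F 2 j γ a₀ ε₀ ε₂₉ B₃ B₉ a₀ a₁' (Efl j γ ε₀ ε₂₉ B₃ B₉ a₀ a₁') (fun p i => Real.log (B16ZLower.zNorm (SU 2) (gOfRecord₁₃ F 2 (theta13OfThm1CCMWZB F 2 j γ a₀ ε₀ ε₂₉ B₃ B₉ a₀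 a₁' (fun _ _ => 0) (fun _ _ => 0)) p i ^ 2) ε))) i (prefixOf gs i)) ∧
      ∀ k : ℕ, ContinuousOn (fun x : ℝ => betaOfRecord₁₃ F 2 (theta13OfThm1CCMWZB F 2 j γ a₀ ε₀ ε₂₉ B₃ B₉ a₀ a₁' (Efl j γ ε₀ ε₂₉ B₃ B₉ a₀ a₁') (fun p i => Real.log (B16ZLower.zNorm (SU 2) (gOfRecord₁₃ F 2 (theta13OfThm1CCMWZB F 2 j γ a₀ ε₀ ε₂₉ B₃ B₉ a₀ a₁' (fun _ _ => 0) (fun _ _ => 0)) p i ^ 2) ε))) k (clampPrefix (betaOfRecord₁₃ F 2 (theta13OfThm1CCMWZB F 2 j γ a₀ ε₀ ε₂₉ B₃ B₉ a₀ a₁' (Efl j γ ε₀ ε₂₉ B₃ B₉ a₀ a₁') (fun p i => Real.log (B16ZLower.zNorm (SU 2) (gOfRecord₁₃ F 2 (theta13OfThm1CCMWZB F 2 j γ a₀ ε₀ ε₂₉ B₃ B₉ a₀ a₁' (fun _ _ => 0) (fun _ _ => 0)) p i ^ 2) ε)))) γ₀ k x))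
        {x : ℝ | 0 < x ∧ x ≤ γ₀ ∧ ∀ i, i ≤ k → 1 / γ₀ ^ 2 ≤ Y (betaOfRecord₁₃ F 2 (theta13OfThm1CCMWZB F 2 j γ a₀ ε₀ ε₂₉ B₃ B₉ a₀ a₁' (Efl j γ ε₀ ε₂₉ B₃ B₉ a₀ a₁') (fun p i => Real.log (B16ZLower.zNorm (SU 2) (gOfRecord₁₃ F 2 (theta13OfThm1CCMWZB F 2 j γ a₀ ε₀ ε₂₉ B₃ B₉ a₀ a₁' (fun _ _ => 0) (fun _ _ => 0)) p i ^ 2) ε)))) γ₀ i x} := by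
    rw [hε₀def]; exact runRows_theta13OfThm1CCMWZB_window_of_half hγpos hγh hrows₁
  have H := hcompBoth_theta13OfThm1CCMWZB_of_betaBoxSignFree (F := F) (N := 2) (j := j) (εbg := a₀) (ε₀ := ε₀) (ε₂₉ := ε₂₉) (Efl := fun _ _ => 0) (logz := fun _ _ => 0) hγh hBpos.le hB9.le ha₀.le ha₁'.le hloW hupW hl hu
  -- the GRID-GUARD Z3 provisos ON THE ᴮ ROAD (k0-s1-w1's `…GuardedZBLam` one-call closer; print's data transfer `hDat_dataSmall7LamTopOf`; the Stage-2 SEAM AS A THEOREM `hseam_holds`)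
  have hPZ : (theta13OfThm1CCMWZB F 2 j γ a₀ ε₀ ε₂₉ B₃ B₉ a₀ a₁' (Efl j γ ε₀ ε₂₉ B₃ B₉ a₀ a₁') (fun p i => Real.log (B16ZLower.zNorm (SU 2) (gOfRecord₁₃ F 2 (theta13OfThm1CCMWZB F 2 j γ a₀ ε₀ ε₂₉ B₃ B₉ a₀ a₁' (fun _ _ => 0) (fun _ _ => 0)) p i ^ 2) ε))).Provisos₁₃SepCoP F 2 :=
    provisos₁₃SepCoP_theta13OfThm1CCMWZB_gridGuard_of_thm1RegSepCoP7MGB_of_thm1GaugeGB_lam F 2 hγpos hγh ha₀ hε hε' hBpos.le hB9.le ha₀ ha₁' hc' hc₀ hc₁ h15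
      (variationalThm1GaugeRegSepCoP7MGB_of_gauge9TopStepGB h9) (hDat_dataSmall7LamTopOf F 2) (hseam_holds F 2) H.1 H.2
  -- dag-n11-d ✓p773221: the engine's FOUR door rows at `θᴳᶻᴮ(π)` from the provisos at `θᴴᶻᴮ(π)` in ONE conjunction (residue-free home of (Z-4)'s rows)
  obtain ⟨hP, hA, hU, hlaws⟩ := doorRows_gaussPinH_ofHistoryBlind_theta13OfThm1CCMWZB hγpos hγh ha₀ hε hε' hBpos.le hB9.le ha₀ ha₁' (ZrOfRecord₁₃ F 2 (theta13OfThm1CCMWZB F 2 j γ a₀ ε₀ ε₂₉ B₃ B₉ a₀ a₁' (Efl j γ ε₀ ε₂₉ B₃ B₉ a₀ a₁') (fun p i => Real.log (B16ZLower.zNorm (SU 2) (gOfRecord₁₃ F 2 (theta13OfThm1CCMWZB F 2 j γ a₀ ε₀ ε₂₉ B₃ B₉ a₀ a₁' (fun _ _ => 0) (fun _ _ => 0)) p i ^ 2) ε)))) hPZ.ofCured.ofHistoryBlind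
  obtain ⟨σ, hσ, hops⟩ := h11N hγpos hγh hε hε' hBpos.le hB9.le ha₀ ha₁' ha₀ρ hε₀def hloZ hupZ hl hu
  -- N13's `h13` family of p650613 §2 ASSEMBLED: level 0 = dag-n13-w1 p643638 at the printed z (+ NODE O row (ii) + `hEfl`); levels ≥ 1 = the displayed a.e. rows; `em ∕ ep := max`
  have mono : ∀ {χ A T d e₁ e₂ p₁ p₂ : ℝ}, 0 ≤ χ → 0 ≤ T → e₁ ≤ e₂ → p₁ ≤ p₂ →
      (χ * Real.exp (A - e₁ * T) ≤ d ∧ d ≤ Real.exp (p₁ * T)) → (χ * Real.exp (A - e₂ * T) ≤ d ∧ d ≤ Real.exp (p₂ * T)) := by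
    intro χ A T d e₁ e₂ p₁ p₂ hχ hT he hp h
    have h1 := mul_le_mul_of_nonneg_right he hT
    exact ⟨le_trans (mul_le_mul_of_nonneg_left (Real.exp_le_exp.mpr (by linarith)) hχ) h.1, h.2.trans (Real.exp_le_exp.mpr (mul_le_mul_of_nonneg_right hp hT))⟩
  obtain ⟨CE, hCE, hE⟩ := hEfl j γ ε₀ ε₂₉ B₃ B₉ a₀ a₁'
  obtain ⟨_, _, γR, M, hγR, -, hpsR, -⟩ := id hrowsE
  obtain ⟨γ₁₃, hγ₁₃, em, ep, hae⟩ := h13posF hγpos hγh hε hε' hBpos.le hB9.le ha₀ ha₁' ha₀ρ hε₀def hloZ hupZ hl hu hP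
  have hγm1 : min γ₁₃ (min γR 1) ≤ 1 := (min_le_right _ _).trans (min_le_right _ _)
  have hγmR : min γ₁₃ (min γR 1) ≤ γR := (min_le_right _ _).trans (min_le_left _ _)
  -- level 0 at the printed z, spelled as in p650613 §2's `h13` (dag-n13-w1's theorem, window converted by `rfl` faces, β ∕ g ∕ χ ∕ backgrounds of the Z member = the blind member's)
  have h0 : ∀ P : B12.RunParams, ((datumOfRecord₁₃SepCoPH F 2 (gaussPinH (Stage13HParams.ofHistoryBlind F 2 ⟨theta13OfThm1CCMWZB F 2 j γ a₀ ε₀ ε₂₉ B₃ B₉ a₀ a₁' (Efl j γ ε₀ ε₂₉ B₃ B₉ a₀ a₁') (fun p i => Real.log (B16ZLower.zNorm (SU 2) (gOfRecord₁₃ F 2 (theta13OfThm1CCMWZB F 2 j γ a₀ ε₀ ε₂₉ B₃ B₉ a₀ a₁' (fun _ _ => 0) (fun _ _ => 0)) p i ^ 2) ε)), ZrOfRecord₁₃ F 2 (theta13OfThm1CCMWZB F 2 j γ a₀ ε₀ ε₂₉ B₃ B₉ a₀ a₁' (Efl j γ ε₀ ε₂₉ B₃ B₉ a₀ a₁') (fun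 p i => Real.log (B16ZLower.zNorm (SU 2) (gOfRecord₁₃ F 2 (theta13OfThm1CCMWZB F 2 j γ a₀ ε₀ ε₂₉ B₃ B₉ a₀ a₁' (fun _ _ => 0) (fun _ _ => 0)) p i ^ 2) ε)))⟩)) hP).C P).flow.InInterval (min γ₁₃ (min γR 1)) P.K →
      ∀ U : GaugeField (F.P P.K) 0 (SU 2),
        chiβOfRecord₁₃ F 2 (theta13OfThm1CCMWZB F 2 j γ a₀ ε₀ ε₂₉ B₃ B₉ a₀ a₁' (Efl j γ ε₀ ε₂₉ B₃ B₉ a₀ a₁') (fun p i => Real.log (B16ZLower.zNorm (SU 2) (gOfRecord₁₃ F 2 (theta13OfThm1CCMWZB F 2 j γ a₀ ε₀ ε₂₉ B₃ B₉ a₀ a₁' (fun _ _ => 0) (fun _ _ => 0)) p i ^ 2) ε))) P.K (gOfRecord₁₃ F 2 (theta13OfThm1CCMWZB F 2 j γ a₀ ε₀ ε₂₉ B₃ B₉ a₀ a₁' (Efl j γ ε₀ ε₂₉ B₃ B₉ a₀ a₁') (fun p i => Real.log (B16ZLower.zNorm (SU 2) (gOfRecord₁₃ F 2 (theta13OfThm1CCMWZB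 F 2 j γ a₀ ε₀ ε₂₉ B₃ B₉ a₀ a₁' (fun _ _ => 0) (fun _ _ => 0)) p i ^ 2) ε))) P) 0 U *
              Real.exp (-(1 / (gOfRecord₁₃ F 2 (theta13OfThm1CCMWZB F 2 j γ a₀ ε₀ ε₂₉ B₃ B₉ a₀ a₁' (Efl j γ ε₀ ε₂₉ B₃ B₉ a₀ a₁') (fun p i => Real.log (B16ZLower.zNorm (SU 2) (gOfRecord₁₃ F 2 (theta13OfThm1CCMWZB F 2 j γ a₀ ε₀ ε₂₉ B₃ B₉ a₀ a₁' (fun _ _ => 0) (fun _ _ => 0)) p i ^ 2) ε))) P 0)) ^ 2 * wilsonBGOfRecord F 2 (theta13OfThm1CCMWZB F 2 j γ a₀ ε₀ ε₂₉ B₃ B₉ a₀ a₁' (Efl j γ ε₀ ε₂₉ B₃ B₉ a₀ a₁') (fun p i => Real.log (B16ZLower.zNorm (SU 2) (gOfRecord₁₃ F 2 (theta13OfThm1CCMWZB F 2 j γ a₀ ε₀ ε₂₉ B₃ B₉ a₀ a₁' (fun _ _ => 0) (fun _ _ => 0)) p i ^ 2) ε))).εbg P 0 U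
                - (4 * max (numerics7OfThm1CCM F.L j ε₀ B₃ B₉ a₀ a₁').logσ₀ 0 + B16ZLower.CzSU 2 ε + CE + 12 * (1 / gOfRecord₁₃ F 2 (theta13OfThm1CCMWZB F 2 j γ a₀ ε₀ ε₂₉ B₃ B₉ a₀ a₁' (Efl j γ ε₀ ε₂₉ B₃ B₉ a₀ a₁') (fun p i => Real.log (B16ZLower.zNorm (SU 2) (gOfRecord₁₃ F 2 (theta13OfThm1CCMWZB F 2 j γ a₀ ε₀ ε₂₉ B₃ B₉ a₀ a₁' (fun _ _ => 0) (fun _ _ => 0)) p i ^ 2) ε))) P 0) ^ 2) * (Fintype.card (Site (F.P P.K) 0) : ℝ)) ≤ densOfRecord₁₃ F 2 (theta13OfThm1CCMWZB F 2 j γ a₀ ε₀ ε₂₉ B₃ B₉ a₀ a₁' (Efl j γ ε₀ ε₂₉ B₃ B₉ a₀ a₁') (fun p i => Real.log (B16ZLower.zNorm (SU 2) (gOfRecord₁₃ F 2 (theta13OfThm1CCMWZB F 2 j γ a₀ ε₀ ε₂₉ B₃ B₉ a₀ a₁' (fun _ _ => 0) (fun _ _ => 0)) p i ^ 2) ε)))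 P 0 U ∧
          densOfRecord₁₃ F 2 (theta13OfThm1CCMWZB F 2 j γ a₀ ε₀ ε₂₉ B₃ B₉ a₀ a₁' (Efl j γ ε₀ ε₂₉ B₃ B₉ a₀ a₁') (fun p i => Real.log (B16ZLower.zNorm (SU 2) (gOfRecord₁₃ F 2 (theta13OfThm1CCMWZB F 2 j γ a₀ ε₀ ε₂₉ B₃ B₉ a₀ a₁' (fun _ _ => 0) (fun _ _ => 0)) p i ^ 2) ε))) P 0 U ≤ Real.exp ((4 * ((dimSU 2 : ℕ) : ℝ) * (Real.log (gOfRecord₁₃ F 2 (theta13OfThm1CCMWZB F 2 j γ a₀ ε₀ ε₂₉ B₃ B₉ a₀ a₁' (Efl j γ ε₀ ε₂₉ B₃ B₉ a₀ a₁') (fun p i => Real.log (B16ZLower.zNorm (SU 2) (gOfRecord₁₃ F 2 (theta13OfThm1CCMWZB F 2 j γ a₀ ε₀ ε₂₉ B₃ B₉ a₀ a₁' (fun _ _ => 0) (fun _ _ => 0)) p i ^ 2) ε))) P 0)⁻¹ + M / 2) + 4 * max (-(numerics7OfThm1CCM F.L j ε₀ B₃ B₉ a₀ a₁').logσ₀)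 0 + CE) * (Fintype.card (Site (F.P P.K) 0) : ℝ)) := fun P hI U =>
    uv_zero_densOfRecord₁₃_theta13OfThm1CCMWZB_printedZ_of_eflAbs_of_inInterval_of_runPartialSumFloor F 2 j γ a₀ ε₀ ε₂₉ B₃ B₉ a₀ a₁' (Efl j γ ε₀ ε₂₉ B₃ B₉ a₀ a₁') hεz hCE hγm1 hγmR P (hE P) hpsR
      (fun k hk => hI k hk) U
  have h13 : ∃ γ₁₃ : ℝ, 0 < γ₁₃ ∧ ∃ em ep : ℝ → ℝ,
        (∀ P : B12.RunParams, ((datumOfRecord₁₃SepCoPH F 2 (gaussPinH (Stage13HParams.ofHistoryBlind F 2 ⟨theta13OfThm1CCMWZB F 2 j γ a₀ ε₀ ε₂₉ B₃ B₉ a₀ a₁' (Efl j γ ε₀ ε₂₉ B₃ B₉ a₀ a₁') (fun p i => Real.log (B16ZLower.zNorm (SU 2) (gOfRecord₁₃ F 2 (theta13OfThm1CCMWZB F 2 j γ a₀ ε₀ ε₂₉ B₃ B₉ a₀ a₁' (fun _ _ => 0) (fun _ _ => 0)) p i ^ 2) ε)), ZrOfRecord₁₃ F 2 (theta13OfThm1CCMWZB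 F 2 j γ a₀ ε₀ ε₂₉ B₃ B₉ a₀ a₁' (Efl j γ ε₀ ε₂₉ B₃ B₉ a₀ a₁') (fun p i => Real.log (B16ZLower.zNorm (SU 2) (gOfRecord₁₃ F 2 (theta13OfThm1CCMWZB F 2 j γ a₀ ε₀ ε₂₉ B₃ B₉ a₀ a₁' (fun _ _ => 0) (fun _ _ => 0)) p i ^ 2) ε)))⟩)) hP).C P).flow.InInterval γ₁₃ P.K → SLaw₁₃CoPH F 2 (gaussPinH (Stage13HParams.ofHistoryBlind F 2 ⟨theta13OfThm1CCMWZB F 2 j γ a₀ ε₀ ε₂₉ B₃ B₉ a₀ a₁' (Efl j γ ε₀ ε₂₉ B₃ B₉ a₀ a₁') (fun p i => Real.log (B16ZLower.zNorm (SU 2) (gOfRecord₁₃ F 2 (theta13OfThm1CCMWZB F 2 j γ a₀ ε₀ ε₂₉ B₃ B₉ a₀ a₁' (fun _ _ => 0) (fun _ _ => 0)) p i ^ 2) ε)), ZrOfRecord₁₃ F 2 (theta13OfThm1CCMWZB F 2 j γ a₀ ε₀ ε₂₉ B₃ B₉ a₀ a₁' (Efl j γ ε₀ ε₂₉ B₃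 B₉ a₀ a₁') (fun p i => Real.log (B16ZLower.zNorm (SU 2) (gOfRecord₁₃ F 2 (theta13OfThm1CCMWZB F 2 j γ a₀ ε₀ ε₂₉ B₃ B₉ a₀ a₁' (fun _ _ => 0) (fun _ _ => 0)) p i ^ 2) ε)))⟩)) P 0 →
      ∀ U : GaugeField (F.P P.K) 0 (SU 2),
        chiβOfRecord₁₃ F 2 (theta13OfThm1CCMWZB F 2 j γ a₀ ε₀ ε₂₉ B₃ B₉ a₀ a₁' (Efl j γ ε₀ ε₂₉ B₃ B₉ a₀ a₁') (fun p i => Real.log (B16ZLower.zNorm (SU 2) (gOfRecord₁₃ F 2 (theta13OfThm1CCMWZB F 2 j γ a₀ ε₀ ε₂₉ B₃ B₉ a₀ a₁' (fun _ _ => 0) (fun _ _ => 0)) p i ^ 2) ε))) P.K (gOfRecord₁₃ F 2 (theta13OfThm1CCMWZB F 2 j γ a₀ ε₀ ε₂₉ B₃ B₉ a₀ a₁' (Efl j γ ε₀ ε₂₉ B₃ B₉ a₀ a₁') (fun p i => Real.log (B16ZLower.zNorm (SU 2) (gOfRecord₁₃ F 2 (theta13OfThm1CCMWZB F 2 j γ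 a₀ ε₀ ε₂₉ B₃ B₉ a₀ a₁' (fun _ _ => 0) (fun _ _ => 0)) p i ^ 2) ε))) P) 0 U *
              Real.exp (-(1 / (gOfRecord₁₃ F 2 (theta13OfThm1CCMWZB F 2 j γ a₀ ε₀ ε₂₉ B₃ B₉ a₀ a₁' (Efl j γ ε₀ ε₂₉ B₃ B₉ a₀ a₁') (fun p i => Real.log (B16ZLower.zNorm (SU 2) (gOfRecord₁₃ F 2 (theta13OfThm1CCMWZB F 2 j γ a₀ ε₀ ε₂₉ B₃ B₉ a₀ a₁' (fun _ _ => 0) (fun _ _ => 0)) p i ^ 2) ε))) P 0) ^ 2 * wilsonBGOfRecord F 2 (theta13OfThm1CCMWZB F 2 j γ a₀ ε₀ ε₂₉ B₃ B₉ a₀ a₁' (Efl j γ ε₀ ε₂₉ B₃ B₉ a₀ a₁') (fun p i => Real.log (B16ZLower.zNorm (SU 2) (gOfRecord₁₃ F 2 (theta13OfThm1CCMWZB F 2 j γ a₀ ε₀ ε₂₉ B₃ B₉ a₀ a₁' (fun _ _ => 0) (fun _ _ => 0)) p i ^ 2) ε))).εbg P 0 U)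
                - em (gOfRecord₁₃ F 2 (theta13OfThm1CCMWZB F 2 j γ a₀ ε₀ ε₂₉ B₃ B₉ a₀ a₁' (Efl j γ ε₀ ε₂₉ B₃ B₉ a₀ a₁') (fun p i => Real.log (B16ZLower.zNorm (SU 2) (gOfRecord₁₃ F 2 (theta13OfThm1CCMWZB F 2 j γ a₀ ε₀ ε₂₉ B₃ B₉ a₀ a₁' (fun _ _ => 0) (fun _ _ => 0)) p i ^ 2) ε))) P 0) * (Fintype.card (Site (F.P P.K) 0) : ℝ)) ≤ densOfRecord₁₃ F 2 (theta13OfThm1CCMWZB F 2 j γ a₀ ε₀ ε₂₉ B₃ B₉ a₀ a₁' (Efl j γ ε₀ ε₂₉ B₃ B₉ a₀ a₁') (fun p i => Real.log (B16ZLower.zNorm (SU 2) (gOfRecord₁₃ F 2 (theta13OfThm1CCMWZB F 2 j γ a₀ ε₀ ε₂₉ B₃ B₉ a₀ a₁' (fun _ _ => 0) (fun _ _ => 0)) p i ^ 2) ε))) P 0 U ∧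
          densOfRecord₁₃ F 2 (theta13OfThm1CCMWZB F 2 j γ a₀ ε₀ ε₂₉ B₃ B₉ a₀ a₁' (Efl j γ ε₀ ε₂₉ B₃ B₉ a₀ a₁') (fun p i => Real.log (B16ZLower.zNorm (SU 2) (gOfRecord₁₃ F 2 (theta13OfThm1CCMWZB F 2 j γ a₀ ε₀ ε₂₉ B₃ B₉ a₀ a₁' (fun _ _ => 0) (fun _ _ => 0)) p i ^ 2) ε))) P 0 U ≤ Real.exp (ep (gOfRecord₁₃ F 2 (theta13OfThm1CCMWZB F 2 j γ a₀ ε₀ ε₂₉ B₃ B₉ a₀ a₁' (Efl j γ ε₀ ε₂₉ B₃ B₉ a₀ a₁') (fun p i => Real.log (B16ZLower.zNorm (SU 2) (gOfRecord₁₃ F 2 (theta13OfThm1CCMWZB F 2 j γ a₀ ε₀ ε₂₉ B₃ B₉ a₀ a₁' (fun _ _ => 0) (fun _ _ => 0)) p i ^ 2) ε))) P 0) * (Fintype.card (Site (F.P P.K) 0) : ℝ))) ∧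
        (∀ P : B12.RunParams, ((datumOfRecord₁₃SepCoPH F 2 (gaussPinH (Stage13HParams.ofHistoryBlind F 2 ⟨theta13OfThm1CCMWZB F 2 j γ a₀ ε₀ ε₂₉ B₃ B₉ a₀ a₁' (Efl j γ ε₀ ε₂₉ B₃ B₉ a₀ a₁') (fun p i => Real.log (B16ZLower.zNorm (SU 2) (gOfRecord₁₃ F 2 (theta13OfThm1CCMWZB F 2 j γ a₀ ε₀ ε₂₉ B₃ B₉ a₀ a₁' (fun _ _ => 0) (fun _ _ => 0)) p i ^ 2) ε)), ZrOfRecord₁₃ F 2 (theta13OfThm1CCMWZB F 2 j γ a₀ ε₀ ε₂₉ B₃ B₉ a₀ a₁' (Efl j γ ε₀ ε₂₉ B₃ B₉ a₀ a₁') (fun p i => Real.log (B16ZLower.zNorm (SU 2) (gOfRecord₁₃ F 2 (theta13OfThm1CCMWZB F 2 j γ a₀ ε₀ ε₂₉ B₃ B₉ a₀ a₁' (fun _ _ => 0) (fun _ _ => 0)) p i ^ 2) ε)))⟩)) hP).C P).flow.InInterval γ₁₃ P.K → ∀ k, k + 1 ≤ P.K → SLaw₁₃CoPH F 2 (gaussPinH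 (Stage13HParams.ofHistoryBlind F 2 ⟨theta13OfThm1CCMWZB F 2 j γ a₀ ε₀ ε₂₉ B₃ B₉ a₀ a₁' (Efl j γ ε₀ ε₂₉ B₃ B₉ a₀ a₁') (fun p i => Real.log (B16ZLower.zNorm (SU 2) (gOfRecord₁₃ F 2 (theta13OfThm1CCMWZB F 2 j γ a₀ ε₀ ε₂₉ B₃ B₉ a₀ a₁' (fun _ _ => 0) (fun _ _ => 0)) p i ^ 2) ε)), ZrOfRecord₁₃ F 2 (theta13OfThm1CCMWZB F 2 j γ a₀ ε₀ ε₂₉ B₃ B₉ a₀ a₁' (Efl j γ ε₀ ε₂₉ B₃ B₉ a₀ a₁') (fun p i => Real.log (B16ZLower.zNorm (SU 2) (gOfRecord₁₃ F 2 (theta13OfThm1CCMWZB F 2 j γ a₀ ε₀ ε₂₉ B₃ B₉ a₀ a₁' (fun _ _ => 0) (fun _ _ => 0)) p i ^ 2) ε)))⟩)) P (k + 1) →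
      ∀ᵐ U ∂(fieldMeasure (F.P P.K) (k + 1) (SU 2)),
        chiβOfRecord₁₃ F 2 (theta13OfThm1CCMWZB F 2 j γ a₀ ε₀ ε₂₉ B₃ B₉ a₀ a₁' (Efl j γ ε₀ ε₂₉ B₃ B₉ a₀ a₁') (fun p i => Real.log (B16ZLower.zNorm (SU 2) (gOfRecord₁₃ F 2 (theta13OfThm1CCMWZB F 2 j γ a₀ ε₀ ε₂₉ B₃ B₉ a₀ a₁' (fun _ _ => 0) (fun _ _ => 0)) p i ^ 2) ε))) P.K (gOfRecord₁₃ F 2 (theta13OfThm1CCMWZB F 2 j γ a₀ ε₀ ε₂₉ B₃ B₉ a₀ a₁' (Efl j γ ε₀ ε₂₉ B₃ B₉ a₀ a₁') (fun p i => Real.log (B16ZLower.zNorm (SU 2) (gOfRecord₁₃ F 2 (theta13OfThm1CCMWZB F 2 j γ a₀ ε₀ ε₂₉ B₃ B₉ a₀ a₁' (fun _ _ => 0) (fun _ _ => 0)) p i ^ 2) ε))) P) (k + 1) U *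
              Real.exp (-(1 / (gOfRecord₁₃ F 2 (theta13OfThm1CCMWZB F 2 j γ a₀ ε₀ ε₂₉ B₃ B₉ a₀ a₁' (Efl j γ ε₀ ε₂₉ B₃ B₉ a₀ a₁') (fun p i => Real.log (B16ZLower.zNorm (SU 2) (gOfRecord₁₃ F 2 (theta13OfThm1CCMWZB F 2 j γ a₀ ε₀ ε₂₉ B₃ B₉ a₀ a₁' (fun _ _ => 0) (fun _ _ => 0)) p i ^ 2) ε))) P (k + 1)) ^ 2 * wilsonBGOfRecord F 2 (theta13OfThm1CCMWZB F 2 j γ a₀ ε₀ ε₂₉ B₃ B₉ a₀ a₁' (Efl j γ ε₀ ε₂₉ B₃ B₉ a₀ a₁') (fun p i => Real.log (B16ZLower.zNorm (SU 2) (gOfRecord₁₃ F 2 (theta13OfThm1CCMWZB F 2 j γ a₀ ε₀ ε₂₉ B₃ B₉ a₀ a₁' (fun _ _ => 0) (fun _ _ => 0)) p i ^ 2) ε))).εbg P (k + 1) U)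
                - em (gOfRecord₁₃ F 2 (theta13OfThm1CCMWZB F 2 j γ a₀ ε₀ ε₂₉ B₃ B₉ a₀ a₁' (Efl j γ ε₀ ε₂₉ B₃ B₉ a₀ a₁') (fun p i => Real.log (B16ZLower.zNorm (SU 2) (gOfRecord₁₃ F 2 (theta13OfThm1CCMWZB F 2 j γ a₀ ε₀ ε₂₉ B₃ B₉ a₀ a₁' (fun _ _ => 0) (fun _ _ => 0)) p i ^ 2) ε))) P (k + 1)) * (Fintype.card (Site (F.P P.K) (k + 1)) : ℝ)) ≤ densOfRecord₁₃ F 2 (theta13OfThm1CCMWZB F 2 j γ a₀ ε₀ ε₂₉ B₃ B₉ a₀ a₁' (Efl j γ ε₀ ε₂₉ B₃ B₉ a₀ a₁') (fun p i => Real.log (B16ZLower.zNorm (SU 2) (gOfRecord₁₃ F 2 (theta13OfThm1CCMWZB F 2 j γ a₀ ε₀ ε₂₉ B₃ B₉ a₀ a₁' (fun _ _ => 0) (fun _ _ => 0)) p i ^ 2) ε))) P (k + 1) U ∧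
          densOfRecord₁₃ F 2 (theta13OfThm1CCMWZB F 2 j γ a₀ ε₀ ε₂₉ B₃ B₉ a₀ a₁' (Efl j γ ε₀ ε₂₉ B₃ B₉ a₀ a₁') (fun p i => Real.log (B16ZLower.zNorm (SU 2) (gOfRecord₁₃ F 2 (theta13OfThm1CCMWZB F 2 j γ a₀ ε₀ ε₂₉ B₃ B₉ a₀ a₁' (fun _ _ => 0) (fun _ _ => 0)) p i ^ 2) ε))) P (k + 1) U ≤ Real.exp (ep (gOfRecord₁₃ F 2 (theta13OfThm1CCMWZB F 2 j γ a₀ ε₀ ε₂₉ B₃ B₉ a₀ a₁' (Efl j γ ε₀ ε₂₉ B₃ B₉ a₀ a₁') (fun p i => Real.log (B16ZLower.zNorm (SU 2) (gOfRecord₁₃ F 2 (theta13OfThm1CCMWZB F 2 j γ a₀ ε₀ ε₂₉ B₃ B₉ a₀ a₁' (fun _ _ => 0) (fun _ _ => 0)) p i ^ 2) ε))) P (k + 1)) * (Fintype.card (Site (F.P P.K) (k + 1)) : ℝ))) := by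
    refine ⟨min γ₁₃ (min γR 1), lt_min hγ₁₃ (lt_min hγR one_pos), fun g => max (em g) (4 * max (numerics7OfThm1CCM F.L j ε₀ B₃ B₉ a₀ a₁').logσ₀ 0 + B16ZLower.CzSU 2 ε + CE + 12 * (1 / g) ^ 2), fun g => max (ep g) (4 * ((dimSU 2 : ℕ) : ℝ) * (Real.log g⁻¹ + M / 2) + 4 * max (-(numerics7OfThm1CCM F.L j ε₀ B₃ B₉ a₀ a₁').logσ₀) 0 + CE), ?_, ?_⟩
    · intro P hI _ U
      -- p643638 writes the Wilson exponent `-(1∕g)²·A`, K1⁹'s text `-(1∕g²·A)`: one `ring` identity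
      have negsq : ∀ g W : ℝ, -(1 / g) ^ 2 * W = -(1 / g ^ 2 * W) := fun g W => by ring
      have h := h0 P hI U
      rw [negsq] at h
      exact mono (chiFix29OfRecord_mem_Icc _ _ P.K 0 U).1 (Nat.cast_nonneg _) (le_max_right _ _) (le_max_right _ _) h
    · intro P hI k hk hS
      have hI' : ((datumOfRecord₁₃SepCoPH F 2 (gaussPinH (Stage13HParams.ofHistoryBlind F 2 ⟨theta13OfThm1CCMWZB F 2 j γ a₀ ε₀ ε₂₉ B₃ B₉ a₀ a₁' (Efl j γ ε₀ ε₂₉ B₃ B₉ a₀ a₁') (fun p i => Real.log (B16ZLower.zNorm (SU 2) (gOfRecord₁₃ F 2 (theta13OfThm1CCMWZB F 2 j γ a₀ ε₀ ε₂₉ B₃ B₉ a₀ a₁' (fun _ _ => 0) (fun _ _ => 0)) p i ^ 2) ε)), ZrOfRecord₁₃ F 2 (theta13OfThm1CCMWZB F 2 j γ a₀ ε₀ ε₂₉ B₃ B₉ a₀ a₁' (Efl j γ ε₀ ε₂₉ B₃ B₉ a₀ a₁') (fun p i => Real.log (B16ZLower.zNorm (SU 2) (gOfRecord₁₃ F 2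 (theta13OfThm1CCMWZB F 2 j γ a₀ ε₀ ε₂₉ B₃ B₉ a₀ a₁' (fun _ _ => 0) (fun _ _ => 0)) p i ^ 2) ε)))⟩)) hP).C P).flow.InInterval γ₁₃ P.K := fun i hi => ⟨(hI i hi).1, (hI i hi).2.trans (min_le_left _ _)⟩
      filter_upwards [hae P hI' k hk hS] with U hU
      exact mono (chiFix29OfRecord_mem_Icc _ _ P.K (k + 1) U).1 (Nat.cast_nonneg _) (le_max_left _ _) (le_max_left _ _) hU
  obtain ⟨cd9, hreg8, haxDom, haxbg, hχregpt, hint9, h11T, hres9, huniq9⟩ := hN09TF hγpos hγh hε hε' hBpos.le hB9.le ha₀ ha₁' ha₀ρ hε₀def hloZ hupZ hl hu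
  -- the two L-only numerics rows of door v1.2 at the SHRUNK ceiling: `36608·a₀ ≤ 1/3`, `64L²·a₀ ≤ 1/3` (`(F.P P.K).d = 4`, `(F.P P.K).L = F.L` by `rfl`; `δ_2 = 1/3`)
  have hδ2 : ExpMeanLog.deltaSU (Fin 2) = 1 / 3 := by
    unfold ExpMeanLog.deltaSU; rw [Fintype.card_fin]; refine min_eq_left ?_; have := Real.pi_gt_three; push_cast; linarith
  have ha₀1 : a₀ * (109824 * (F.L : ℝ) ^ 2) ≤ 1 := (le_div_iff₀ hL2).1 ha₀ρ
  have hbg3 : ∀ P : B12.RunParams, (143 * (((((F.P P.K).d + 4 : ℕ) : ℝ)) ^ 2 / 4) ^ 2) * a₀ ≤ 1 / 3 := by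
    intro P; show (143 * ((((4 + 4 : ℕ) : ℝ)) ^ 2 / 4) ^ 2) * a₀ ≤ 1 / 3; push_cast; nlinarith [ha₀1, hL8, ha₀.le]
  have hbg2 : ∀ P : B12.RunParams, 2 * a₀ ≤ 2 * ExpMeanLog.deltaSU (Fin 2) / ((((F.P P.K).d + 4) * (F.P P.K).L : ℕ) : ℝ) ^ 2 := by
    intro P; rw [hδ2]; show 2 * a₀ ≤ 2 * (1 / 3) / ((((4 + 4) * F.L : ℕ) : ℝ)) ^ 2; push_cast
    rw [le_div_iff₀ (by positivity)]; nlinarith [ha₀1, hL8, ha₀.le]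
  obtain ⟨Y₀, h6⟩ := h06F hγpos hγh hε hε' hBpos.le hB9.le ha₀ ha₁' ha₀ρ hε₀def hloZ hupZ hl hu
  exact N24_stabilityBRunRowsR13SepCoPHV_consequent_childrenSplitSlot8Thm1AE_atWitness_pinY₀_of_runRowsCont Slot8
    (gaussPinH (Stage13HParams.ofHistoryBlind F 2 ⟨theta13OfThm1CCMWZB F 2 j γ a₀ ε₀ ε₂₉ B₃ B₉ a₀ a₁' (Efl j γ ε₀ ε₂₉ B₃ B₉ a₀ a₁') (fun p i => Real.log (B16ZLower.zNorm (SU 2) (gOfRecord₁₃ F 2 (theta13OfThm1CCMWZB F 2 j γ a₀ ε₀ ε₂₉ B₃ B₉ a₀ a₁' (fun _ _ => 0) (fun _ _ => 0)) p i ^ 2) ε)), ZrOfRecord₁₃ F 2 (theta13OfThm1CCMWZB F 2 j γ a₀ ε₀ ε₂₉ B₃ B₉ a₀ a₁' (Efl j γ ε₀ ε₂₉ B₃ B₉ a₀ a₁') (fun p i => Real.log (B16ZLower.zNorm (SU 2) (gOfRecord₁₃ F 2 (theta13OfThm1CCMWZB F 2 j γ a₀ ε₀ ε₂₉ B₃ B₉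 a₀ a₁' (fun _ _ => 0) (fun _ _ => 0)) p i ^ 2) ε)))⟩)) hP
    hA hU hlaws hγpos hupZ
    (h05F hγpos hγh hε hε' hBpos.le hB9.le ha₀ ha₁' ha₀ρ hε₀def hloZ hupZ hl hu) _ h6 h07 h08
    (h09F hγpos hγh hε hε' hBpos.le hB9.le ha₀ ha₁' ha₀ρ hε₀def hloZ hupZ hl hu) ⟨1, one_pos, fun _ hC _ => thm3Member_forall_stage13SepCoPH_onDomains_of_axialOn_of_reg8_of_suppPt _ hP hC cd9 hreg8 le_rfl ha₀.le haxDom haxbg hχregpt hint9 h11T hres9 huniq9 hε' ha₀ hbg3 hbg2 hbg₀⟩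
    (h10F hγpos hγh hε hε' hBpos.le hB9.le ha₀ ha₁' ha₀ρ hε₀def hloZ hupZ hl hu)
    (h11Family_gaussPinH_ofHistoryBlind_theta13OfThm1CCMWZB_of_exists_supplier_windowed hγpos hγh ha₀ hε hε' hBpos.le hB9.le ha₀ ha₁' _ hP hγpos ⟨σ, hσ, hops⟩)
    h13
    hrowsE

/-- **★★★★ K1⁹ `StabilityBRunRowsAtRecordR13SepCoPHV` (stmt-QuantumFields-27364) BY ITS ROUTE NAME ON THE V21-G K0 FACE AT THE GAUSS PIN OF THE PRINTED-z MEMBER, `Slot8` PARAMETRIC, N13's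
LEVEL-0 FACE CONSUMED** — from K0⁷'s two REGISTERED V22-Z stubs BY NAME (`Prop8StepCoPGridGAt`, `AbsBetaBoxAtThm1WitnessCCMGenGridGZAt` — DEF-1's `K0V22ZDefs` §1; `fun F => stub_… F` feeds both by δ), the road-free slot families (N05 at `Slot8`;
N07, N08, N09's Lemma-4 leaf `h09` + N09's eight THEOREM-3 INPUT rows `hN09T` (edition «N09T», dag-n09-w2's door BY NAME, `hle := le_rfl`), N10; N06 = the carrier-generic SOCKET `h06`, JUNK-INHABITABLE — header SOCKETS), N11's `h11N`, the `Efl` volume bound, N13's a.e. rows at levels ≥ 1, NODE O's run rows — all READ AT the Gauss-pin certificate of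
`theta13OfThm1CCMWZ F 2 j γ … (Efl F j γ …) (fun p i => Real.log (B16ZLower.zNorm (SU 2) (gOfRecord₁₃ F 2 (theta13OfThm1CCMW F 2 j γ …) p i ^ 2) ε))` (print's [I] (0.15) normalisation, door-wise).
THE K1⁹ KERNEL SENTENCE ON K0's V22-Z FACE (3ᴬ′ AT THE Z3 MEMBER `εbg := a₀`, LETTER-FREE) ON THE SLOT ROAD AT THE PRINTED NORMALISATION.  CONDITIONAL (audit `proof.conditional`); not a closure; NO V21-G ∕ v10 stub proved or
closed; no count moved. [cite: Balaban1989LargeFieldII, Thm 1 p.355, (0.1) pp.355–356, (0.15) p.360, p.391; Balaban1988Convergent, Theorem p.245, Cor. 3 (2.50) p.264, (0.2) p.244, (1.15) p.249, (2.1) p.254, (2.5)–(2.8) pp.255–256, (3.16)–(3.25) pp.268–270, §3 p.279; Balaban1987RG1, (0.1) p.251, (0.14)–(0.17) pp.254–255, (0.20) p.256, Thm 3 p.264, (1.20)–(1.22) p.264, §1 pp.263–264; Balaban1985RegularSpaces, Prop. 7 (1.145) p.100, Thm 8 (1.146) p.101 (bookkeeping); Balaban1987RG1, Thm 3 p.264,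 (2.1)–(2.3) p.265, (2.9)–(2.10) pp.266–267; Balaban1985Variational, Thm 1 (6), (8)–(10) p.279 and (181) p.307; Balaban1985Averaging, Prop. 2 (53) p.26] -/
theorem N24_stabilityBRunRowsAtRecordR13SepCoPHV_byName_of_cofinalBetaSocketZBV23_of_childrenSplitSlot8DoorPinnedN09Thm3InputsN11SupplierRowsThm1AEPos_atGaussPinPrintedZB_pinY (Slot8 : (θ₃ : Stage3Params) → ResidB8 θ₃ → Prop) (ε : ℝ) (hεz : 0 < ε)
    (Efl : T4Family → ℕ → ℝ → ℝ → ℝ → ℝ → ℝ → ℝ → ℝ → B12.RunParams → ℕ → ℝ)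
    (h05 : ∀ (F : T4Family) {j : ℕ} {γ ε₀ ε₂₉ B₃ B₃' a₀ a₁ : ℝ} (hγ₀ : 0 < γ) (hγh : γ ≤ 1 / 2) (hε : 0 < ε₀) (hε' : 0 < ε₂₉) (hB : 0 ≤ B₃) (hB' : 0 ≤ B₃') (ha₀ : 0 < a₀) (ha₁ : 0 < a₁) (ha₀ρ : a₀ ≤ 1 / (109824 * (F.L : ℝ) ^ 2)) (hε₀ρ : ε₀ = a₀) {bl β' : ℝ} (hbox : BetaLowerH bl γ (betaOfRecord₁₃ F 2 (theta13OfThm1CCMWZB F 2 j γ a₀ ε₀ ε₂₉ B₃ B₃' a₀ a₁ (Efl F j γ ε₀ ε₂₉ B₃ B₃' a₀ a₁) (fun p i => Real.log (B16ZLower.zNorm (SU 2) (gOfRecord₁₃ F 2 (theta13OfThm1CCMWZB F 2 j γ a₀ ε₀ ε₂₉ B₃ B₃' a₀ a₁ (fun _ _ => 0) (fun _ _ => 0)) p i ^ 2) ε))))) (hbox' : BetaUpperH β' γ (betaOfRecord₁₃ F 2 (theta13OfThm1CCMWZB F 2 j γ a₀ ε₀ ε₂₉ B₃ B₃' a₀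 a₁ (Efl F j γ ε₀ ε₂₉ B₃ B₃' a₀ a₁) (fun p i => Real.log (B16ZLower.zNorm (SU 2) (gOfRecord₁₃ F 2 (theta13OfThm1CCMWZB F 2 j γ a₀ ε₀ ε₂₉ B₃ B₃' a₀ a₁ (fun _ _ => 0) (fun _ _ => 0)) p i ^ 2) ε))))) (hl : -bl * γ ^ 2 ≤ 3) (hβ' : β' * γ ^ 2 ≤ 3 / 4),
      ∃ lam8 : ResidB8 (theta13OfThm1CCMWZB F 2 j γ a₀ ε₀ ε₂₉ B₃ B₃' a₀ a₁ (Efl F j γ ε₀ ε₂₉ B₃ B₃' a₀ a₁) (fun p i => Real.log (B16ZLower.zNorm (SU 2) (gOfRecord₁₃ F 2 (theta13OfThm1CCMWZB F 2 j γ a₀ ε₀ ε₂₉ B₃ B₃' a₀ a₁ (fun _ _ => 0) (fun _ _ => 0)) p i ^ 2) ε))).toStage3Params, Slot8 (theta13OfThm1CCMWZB F 2 j γ a₀ ε₀ ε₂₉ B₃ B₃' a₀ a₁ (Efl F j γ ε₀ ε₂₉ B₃ B₃' a₀ a₁) (fun p i => Real.log (B16ZLower.zNorm (SU 2) (gOfRecord₁₃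 F 2 (theta13OfThm1CCMWZB F 2 j γ a₀ ε₀ ε₂₉ B₃ B₃' a₀ a₁ (fun _ _ => 0) (fun _ _ => 0)) p i ^ 2) ε))).toStage3Params lam8)
    (h06 : ∀ (F : T4Family) {j : ℕ} {γ ε₀ ε₂₉ B₃ B₃' a₀ a₁ : ℝ} (hγ₀ : 0 < γ) (hγh : γ ≤ 1 / 2) (hε : 0 < ε₀) (hε' : 0 < ε₂₉) (hB : 0 ≤ B₃) (hB' : 0 ≤ B₃') (ha₀ : 0 < a₀) (ha₁ : 0 < a₁) (ha₀ρ : a₀ ≤ 1 / (109824 * (F.L : ℝ) ^ 2)) (hε₀ρ : ε₀ = a₀) {bl β' : ℝ} (hbox : BetaLowerH bl γ (betaOfRecord₁₃ F 2 (theta13OfThm1CCMWZB F 2 j γ a₀ ε₀ ε₂₉ B₃ B₃' a₀ a₁ (Efl F j γ ε₀ ε₂₉ B₃ B₃' a₀ a₁) (fun p i => Real.log (B16ZLower.zNorm (SU 2) (gOfRecord₁₃ F 2 (theta13OfThm1CCMWZB F 2 j γ a₀ ε₀ ε₂₉ B₃ B₃' a₀ a₁ (fun _ _ => 0) (fun _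 _ => 0)) p i ^ 2) ε))))) (hbox' : BetaUpperH β' γ (betaOfRecord₁₃ F 2 (theta13OfThm1CCMWZB F 2 j γ a₀ ε₀ ε₂₉ B₃ B₃' a₀ a₁ (Efl F j γ ε₀ ε₂₉ B₃ B₃' a₀ a₁) (fun p i => Real.log (B16ZLower.zNorm (SU 2) (gOfRecord₁₃ F 2 (theta13OfThm1CCMWZB F 2 j γ a₀ ε₀ ε₂₉ B₃ B₃' a₀ a₁ (fun _ _ => 0) (fun _ _ => 0)) p i ^ 2) ε))))) (hl : -bl * γ ^ 2 ≤ 3) (hβ' : β' * γ ^ 2 ≤ 3 / 4),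
      ∃ Y₀ : PrintedCarriers9X, B9LeafX Y₀)
    (h07 : ∀ F : T4Family, ∃ ζ : ResidZ F 2, B11Leaf (Z11OfRecord F 2 ζ))
    (h08 : ∀ F : T4Family, PrintedUV3V 2 F.L)
    (h09 : ∀ (F : T4Family) {j : ℕ} {γ ε₀ ε₂₉ B₃ B₃' a₀ a₁ : ℝ} (hγ₀ : 0 < γ) (hγh : γ ≤ 1 / 2) (hε : 0 < ε₀) (hε' : 0 < ε₂₉) (hB : 0 ≤ B₃) (hB' : 0 ≤ B₃') (ha₀ : 0 < a₀) (ha₁ : 0 < a₁) (ha₀ρ : a₀ ≤ 1 / (109824 * (F.L : ℝ) ^ 2)) (hε₀ρ : ε₀ = a₀) {bl β' : ℝ} (hbox : BetaLowerH bl γ (betaOfRecord₁₃ F 2 (theta13OfThm1CCMWZB F 2 j γ a₀ ε₀ ε₂₉ B₃ B₃' a₀ a₁ (Efl F j γ ε₀ ε₂₉ B₃ B₃' a₀ a₁) (fun p i => Real.log (B16ZLower.zNorm (SU 2) (gOfRecord₁₃ F 2 (theta13OfThm1CCMWZB F 2 j γ a₀ ε₀ ε₂₉ B₃ B₃' a₀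 a₁ (fun _ _ => 0) (fun _ _ => 0)) p i ^ 2) ε))))) (hbox' : BetaUpperH β' γ (betaOfRecord₁₃ F 2 (theta13OfThm1CCMWZB F 2 j γ a₀ ε₀ ε₂₉ B₃ B₃' a₀ a₁ (Efl F j γ ε₀ ε₂₉ B₃ B₃' a₀ a₁) (fun p i => Real.log (B16ZLower.zNorm (SU 2) (gOfRecord₁₃ F 2 (theta13OfThm1CCMWZB F 2 j γ a₀ ε₀ ε₂₉ B₃ B₃' a₀ a₁ (fun _ _ => 0) (fun _ _ => 0)) p i ^ 2) ε))))) (hl : -bl * γ ^ 2 ≤ 3) (hβ' : β' * γ ^ 2 ≤ 3 / 4),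
      ∃ lam12 : ResidB12 F 2 (theta13OfThm1CCMWZB F 2 j γ a₀ ε₀ ε₂₉ B₃ B₃' a₀ a₁ (Efl F j γ ε₀ ε₂₉ B₃ B₃' a₀ a₁) (fun p i => Real.log (B16ZLower.zNorm (SU 2) (gOfRecord₁₃ F 2 (theta13OfThm1CCMWZB F 2 j γ a₀ ε₀ ε₂₉ B₃ B₃' a₀ a₁ (fun _ _ => 0) (fun _ _ => 0)) p i ^ 2) ε))).τ9.M,
      ∀ P : B12.RunParams, B12Sec2to5.Lemma4Printed (F12OfRecord₁₂ F 2 (theta13OfThm1CCMWZB F 2 j γ a₀ ε₀ ε₂₉ B₃ B₃' a₀ a₁ (Efl F j γ ε₀ ε₂₉ B₃ B₃' a₀ a₁) (fun p i => Real.log (B16ZLower.zNorm (SU 2) (gOfRecord₁₃ F 2 (theta13OfThm1CCMWZB F 2 j γ a₀ ε₀ ε₂₉ B₃ B₃' a₀ a₁ (fun _ _ => 0) (fun _ _ => 0)) p i ^ 2) ε))).toStage12Params lam12 P) (lam12 P).consts)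
    (hN09T : ∀ (F : T4Family) {j : ℕ} {γ ε₀ ε₂₉ B₃ B₃' a₀ a₁ : ℝ} (hγ₀ : 0 < γ) (hγh : γ ≤ 1 / 2) (hε : 0 < ε₀) (hε' : 0 < ε₂₉) (hB : 0 ≤ B₃) (hB' : 0 ≤ B₃') (ha₀ : 0 < a₀) (ha₁ : 0 < a₁) (ha₀ρ : a₀ ≤ 1 / (109824 * (F.L : ℝ) ^ 2)) (hε₀ρ : ε₀ = a₀) {bl β' : ℝ} (hbox : BetaLowerH bl γ (betaOfRecord₁₃ F 2 (theta13OfThm1CCMWZB F 2 j γ a₀ ε₀ ε₂₉ B₃ B₃' a₀ a₁ (Efl F j γ ε₀ ε₂₉ B₃ B₃' a₀ a₁) (fun p i => Real.log (B16ZLower.zNorm (SU 2) (gOfRecord₁₃ F 2 (theta13OfThm1CCMWZB F 2 j γ a₀ ε₀ ε₂₉ B₃ B₃' a₀ a₁ (fun _ _ => 0) (fun _ _ => 0)) p i ^ 2) ε))))) (hbox' : BetaUpperH β' γ (betaOfRecord₁₃ F 2 (theta13OfThm1CCMWZB F 2 j γ a₀ ε₀ ε₂₉ B₃ B₃' a₀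 a₁ (Efl F j γ ε₀ ε₂₉ B₃ B₃' a₀ a₁) (fun p i => Real.log (B16ZLower.zNorm (SU 2) (gOfRecord₁₃ F 2 (theta13OfThm1CCMWZB F 2 j γ a₀ ε₀ ε₂₉ B₃ B₃' a₀ a₁ (fun _ _ => 0) (fun _ _ => 0)) p i ^ 2) ε))))) (hl : -bl * γ ^ 2 ≤ 3) (hβ' : β' * γ ^ 2 ≤ 3 / 4),
      ∃ cd : (P : B12.RunParams) → (i : ℕ) → ContourData (F.P P.K) i (SU 2),
        (∀ (P : B12.RunParams) (k : ℕ), k ≤ P.K → ∀ V ∈ domAltOfRecord F 2 (numerics7OfThm1CCM F.L j ε₀ B₃ B₃' a₀ a₁) P.K k, Uk F 2 P.K k a₀ V ∈ bgReg F 2 P.K k a₀) ∧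
        (∀ (P : B12.RunParams), ∀ i < P.K, ∀ W ∈ domAltOfRecord F 2 (numerics7OfThm1CCM F.L j ε₀ B₃ B₃' a₀ a₁) P.K (i + 1), AxialGauge (cd P i) (critCfgOfRecord F 2 (numerics7OfThm1CCM F.L j ε₀ B₃ B₃' a₀ a₁) P.K i W)) ∧
        (∀ (P : B12.RunParams) (k : ℕ), k ≤ P.K → ∀ V ∈ domAltOfRecord F 2 (numerics7OfThm1CCM F.L j ε₀ B₃ B₃' a₀ a₁) P.K k, ∀ i < k, AxialGauge (cd P i) (Averaging.iter (avOfRecord F 2 P.K) i (Uk F 2 P.K k a₀ V))) ∧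
        (∀ (P : B12.RunParams) (i : ℕ), i + 1 < P.K → ∀ U : GaugeField (F.P P.K) (i + 1) (SU 2), (avOfRecord F 2 P.K (i + 1)).avg U ∈ domAltOfRecord F 2 (numerics7OfThm1CCM F.L j ε₀ B₃ B₃' a₀ a₁) P.K (i + 2) →
          U ∉ regSetOfRecord F 2 P.K i (betaInputOfRecord F 2 (TβOfRecord₁₃ F 2) (chiβOfRecord₁₃ F 2 (theta13OfThm1CCMWZB F 2 j γ a₀ ε₀ ε₂₉ B₃ B₃' a₀ a₁ (Efl F j γ ε₀ ε₂₉ B₃ B₃' a₀ a₁) (fun p i => Real.log (B16ZLower.zNorm (SU 2) (gOfRecord₁₃ F 2 (theta13OfThm1CCMWZB F 2 j γ a₀ ε₀ ε₂₉ B₃ B₃' a₀ a₁ (fun _ _ => 0) (fun _ _ => 0)) p i ^ 2) ε)))) P.K (gOfRecord₁₃ F 2 (theta13OfThm1CCMWZB F 2 j γ a₀ ε₀ ε₂₉ B₃ B₃' a₀ a₁ (Efl F j γ ε₀ ε₂₉ B₃ B₃' a₀ a₁) (fun p i => Real.log (B16ZLower.zNorm (SU 2) (gOfRecord₁₃ F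 2 (theta13OfThm1CCMWZB F 2 j γ a₀ ε₀ ε₂₉ B₃ B₃' a₀ a₁ (fun _ _ => 0) (fun _ _ => 0)) p i ^ 2) ε))) P) i) ∩ domAltOfRecord F 2 (numerics7OfThm1CCM F.L j ε₀ B₃ B₃' a₀ a₁) P.K (i + 1) →
            chiβOfRecord₁₃ F 2 (theta13OfThm1CCMWZB F 2 j γ a₀ ε₀ ε₂₉ B₃ B₃' a₀ a₁ (Efl F j γ ε₀ ε₂₉ B₃ B₃' a₀ a₁) (fun p i => Real.log (B16ZLower.zNorm (SU 2) (gOfRecord₁₃ F 2 (theta13OfThm1CCMWZB F 2 j γ a₀ ε₀ ε₂₉ B₃ B₃' a₀ a₁ (fun _ _ => 0) (fun _ _ => 0)) p i ^ 2) ε))) P.K (gOfRecord₁₃ F 2 (theta13OfThm1CCMWZB F 2 j γ a₀ ε₀ ε₂₉ B₃ B₃' a₀ a₁ (Efl F j γ ε₀ ε₂₉ B₃ B₃' a₀ a₁) (fun p i => Real.log (B16ZLower.zNorm (SU 2) (gOfRecord₁₃ F 2 (theta13OfThm1CCMWZB F 2 j γ a₀ ε₀ ε₂₉ B₃ B₃'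 a₀ a₁ (fun _ _ => 0) (fun _ _ => 0)) p i ^ 2) ε))) P) (i + 1) U = 0) ∧
        (∀ (P : B12.RunParams), ∀ i < P.K, MeasureTheory.Integrable (betaInputOfRecord F 2 (TβOfRecord₁₃ F 2) (chiβOfRecord₁₃ F 2 (theta13OfThm1CCMWZB F 2 j γ a₀ ε₀ ε₂₉ B₃ B₃' a₀ a₁ (Efl F j γ ε₀ ε₂₉ B₃ B₃' a₀ a₁) (fun p i => Real.log (B16ZLower.zNorm (SU 2) (gOfRecord₁₃ F 2 (theta13OfThm1CCMWZB F 2 j γ a₀ ε₀ ε₂₉ B₃ B₃' a₀ a₁ (fun _ _ => 0) (fun _ _ => 0)) p i ^ 2) ε)))) P.K (gOfRecord₁₃ F 2 (theta13OfThm1CCMWZB F 2 j γ a₀ ε₀ ε₂₉ B₃ B₃' a₀ a₁ (Efl F j γ ε₀ ε₂₉ B₃ B₃' a₀ a₁) (fun p i => Real.log (B16ZLower.zNorm (SU 2) (gOfRecord₁₃ F 2 (theta13OfThm1CCMWZB F 2 j γ a₀ ε₀ ε₂₉ B₃ B₃' a₀ a₁ (fun _ _ => 0) (fun _ _ => 0))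 p i ^ 2) ε))) P) i) (fieldMeasure (F.P P.K) i (SU 2))) ∧
        (∀ (P : B12.RunParams) (k : ℕ), k ≤ P.K → ∀ V ∈ domAltOfRecord F 2 (numerics7OfThm1CCM F.L j ε₀ B₃ B₃' a₀ a₁) P.K k, UkExists F 2 P.K k a₀ V ∧ UniqueUkOrbit F 2 P.K k a₀ V) ∧
        (∀ (P : B12.RunParams) (k : ℕ), k ≤ P.K → HRestrict F 2 a₀ P.K k (domAltOfRecord F 2 (numerics7OfThm1CCM F.L j ε₀ B₃ B₃' a₀ a₁) P.K k)) ∧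
        (∀ (P : B12.RunParams) (k : ℕ), k ≤ P.K → ∀ V ∈ domAltOfRecord F 2 (numerics7OfThm1CCM F.L j ε₀ B₃ B₃' a₀ a₁) P.K k, ∀ i < k, UniqueUkOrbit F 2 P.K (i + 1) a₀ (Averaging.iter (avOfRecord F 2 P.K) (i + 1) (Uk F 2 P.K k a₀ V))))
    (h10 : ∀ (F : T4Family) {j : ℕ} {γ ε₀ ε₂₉ B₃ B₃' a₀ a₁ : ℝ} (hγ₀ : 0 < γ) (hγh : γ ≤ 1 / 2) (hε : 0 < ε₀) (hε' : 0 < ε₂₉) (hB : 0 ≤ B₃) (hB' : 0 ≤ B₃') (ha₀ : 0 < a₀) (ha₁ : 0 < a₁) (ha₀ρ : a₀ ≤ 1 / (109824 * (F.L : ℝ) ^ 2)) (hε₀ρ : ε₀ = a₀) {bl β' : ℝ} (hbox : BetaLowerH bl γ (betaOfRecord₁₃ F 2 (theta13OfThm1CCMWZB F 2 j γ a₀ ε₀ ε₂₉ B₃ B₃' a₀ a₁ (Efl F j γ ε₀ ε₂₉ B₃ B₃' a₀ a₁) (fun p i => Real.log (B16ZLower.zNorm (SU 2) (gOfRecord₁₃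 F 2 (theta13OfThm1CCMWZB F 2 j γ a₀ ε₀ ε₂₉ B₃ B₃' a₀ a₁ (fun _ _ => 0) (fun _ _ => 0)) p i ^ 2) ε))))) (hbox' : BetaUpperH β' γ (betaOfRecord₁₃ F 2 (theta13OfThm1CCMWZB F 2 j γ a₀ ε₀ ε₂₉ B₃ B₃' a₀ a₁ (Efl F j γ ε₀ ε₂₉ B₃ B₃' a₀ a₁) (fun p i => Real.log (B16ZLower.zNorm (SU 2) (gOfRecord₁₃ F 2 (theta13OfThm1CCMWZB F 2 j γ a₀ ε₀ ε₂₉ B₃ B₃' a₀ a₁ (fun _ _ => 0) (fun _ _ => 0)) p i ^ 2) ε))))) (hl : -bl * γ ^ 2 ≤ 3) (hβ' : β' * γ ^ 2 ≤ 3 / 4),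
      ∃ lam13 : B12.RunParams → ResidB13 (theta13OfThm1CCMWZB F 2 j γ a₀ ε₀ ε₂₉ B₃ B₃' a₀ a₁ (Efl F j γ ε₀ ε₂₉ B₃ B₃' a₀ a₁) (fun p i => Real.log (B16ZLower.zNorm (SU 2) (gOfRecord₁₃ F 2 (theta13OfThm1CCMWZB F 2 j γ a₀ ε₀ ε₂₉ B₃ B₃' a₀ a₁ (fun _ _ => 0) (fun _ _ => 0)) p i ^ 2) ε))).toStage3Params,
      ∀ P : B12.RunParams, B13LeafOfRecord (theta13OfThm1CCMWZB F 2 j γ a₀ ε₀ ε₂₉ B₃ B₃' a₀ a₁ (Efl F j γ ε₀ ε₂₉ B₃ B₃' a₀ a₁) (fun p i => Real.log (B16ZLower.zNorm (SU 2) (gOfRecord₁₃ F 2 (theta13OfThm1CCMWZB F 2 j γ a₀ ε₀ ε₂₉ B₃ B₃' a₀ a₁ (fun _ _ => 0) (fun _ _ => 0)) p i ^ 2) ε))).toStage3Params (lam13 P))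
    (h11N : ∀ (F : T4Family) {j : ℕ} {γ ε₀ ε₂₉ B₃ B₃' a₀ a₁ : ℝ} (hγ₀ : 0 < γ) (hγh : γ ≤ 1 / 2) (hε : 0 < ε₀) (hε' : 0 < ε₂₉) (hB : 0 ≤ B₃) (hB' : 0 ≤ B₃') (ha₀ : 0 < a₀) (ha₁ : 0 < a₁) (ha₀ρ : a₀ ≤ 1 / (109824 * (F.L : ℝ) ^ 2)) (hε₀ρ : ε₀ = a₀) {bl β' : ℝ} (hbox : BetaLowerH bl γ (betaOfRecord₁₃ F 2 (theta13OfThm1CCMWZB F 2 j γ a₀ ε₀ ε₂₉ B₃ B₃' a₀ a₁ (Efl F j γ ε₀ ε₂₉ B₃ B₃' a₀ a₁) (fun p i => Real.log (B16ZLower.zNorm (SU 2) (gOfRecord₁₃ F 2 (theta13OfThm1CCMWZB F 2 j γ a₀ ε₀ ε₂₉ B₃ B₃' a₀ a₁ (fun _ _ => 0) (fun _ _ => 0)) p i ^ 2) ε))))) (hbox' : BetaUpperH β' γ (betaOfRecord₁₃ F 2 (theta13OfThm1CCMWZB F 2 j γ a₀ ε₀ ε₂₉ B₃ B₃' a₀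 a₁ (Efl F j γ ε₀ ε₂₉ B₃ B₃' a₀ a₁) (fun p i => Real.log (B16ZLower.zNorm (SU 2) (gOfRecord₁₃ F 2 (theta13OfThm1CCMWZB F 2 j γ a₀ ε₀ ε₂₉ B₃ B₃' a₀ a₁ (fun _ _ => 0) (fun _ _ => 0)) p i ^ 2) ε))))) (hl : -bl * γ ^ 2 ≤ 3) (hβ' : β' * γ ^ 2 ≤ 3 / 4),
      ∃ σ : (P : B12.RunParams) → Sect3Supplier (gaussPinH (Stage13HParams.ofHistoryBlind F 2 ⟨theta13OfThm1CCMWZB F 2 j γ a₀ ε₀ ε₂₉ B₃ B₃' a₀ a₁ (Efl F j γ ε₀ ε₂₉ B₃ B₃' a₀ a₁) (fun p i => Real.log (B16ZLower.zNorm (SU 2) (gOfRecord₁₃ F 2 (theta13OfThm1CCMWZB F 2 j γ a₀ ε₀ ε₂₉ B₃ B₃' a₀ a₁ (fun _ _ => 0) (fun _ _ => 0)) p i ^ 2) ε)), ZrOfRecord₁₃ F 2 (theta13OfThm1CCMWZB F 2 j γ a₀ ε₀ ε₂₉ B₃ B₃' a₀ a₁ (Efl F j γ ε₀ ε₂₉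 B₃ B₃' a₀ a₁) (fun p i => Real.log (B16ZLower.zNorm (SU 2) (gOfRecord₁₃ F 2 (theta13OfThm1CCMWZB F 2 j γ a₀ ε₀ ε₂₉ B₃ B₃' a₀ a₁ (fun _ _ => 0) (fun _ _ => 0)) p i ^ 2) ε)))⟩)) P,
        (∀ P : B12.RunParams, Step.InInterval γ P.K (gOfRecord₁₃ F 2 (theta13OfThm1CCMWZB F 2 j γ a₀ ε₀ ε₂₉ B₃ B₃' a₀ a₁ (Efl F j γ ε₀ ε₂₉ B₃ B₃' a₀ a₁) (fun p i => Real.log (B16ZLower.zNorm (SU 2) (gOfRecord₁₃ F 2 (theta13OfThm1CCMWZB F 2 j γ a₀ ε₀ ε₂₉ B₃ B₃' a₀ a₁ (fun _ _ => 0) (fun _ _ => 0)) p i ^ 2) ε))) P) → SupplierObligations (gaussPinH (Stage13HParams.ofHistoryBlind F 2 ⟨theta13OfThm1CCMWZB F 2 j γ a₀ ε₀ ε₂₉ B₃ B₃' a₀ a₁ (Efl F j γ ε₀ ε₂₉ B₃ B₃' a₀ a₁) (fun p i => Real.log (B16ZLower.zNorm (SU 2) (gOfRecord₁₃ F 2 (theta13OfThm1CCMWZB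 F 2 j γ a₀ ε₀ ε₂₉ B₃ B₃' a₀ a₁ (fun _ _ => 0) (fun _ _ => 0)) p i ^ 2) ε)), ZrOfRecord₁₃ F 2 (theta13OfThm1CCMWZB F 2 j γ a₀ ε₀ ε₂₉ B₃ B₃' a₀ a₁ (Efl F j γ ε₀ ε₂₉ B₃ B₃' a₀ a₁) (fun p i => Real.log (B16ZLower.zNorm (SU 2) (gOfRecord₁₃ F 2 (theta13OfThm1CCMWZB F 2 j γ a₀ ε₀ ε₂₉ B₃ B₃' a₀ a₁ (fun _ _ => 0) (fun _ _ => 0)) p i ^ 2) ε)))⟩)) P (σ P)) ∧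
        (∀ P : B12.RunParams, Step.InInterval γ P.K (gOfRecord₁₃ F 2 (theta13OfThm1CCMWZB F 2 j γ a₀ ε₀ ε₂₉ B₃ B₃' a₀ a₁ (Efl F j γ ε₀ ε₂₉ B₃ B₃' a₀ a₁) (fun p i => Real.log (B16ZLower.zNorm (SU 2) (gOfRecord₁₃ F 2 (theta13OfThm1CCMWZB F 2 j γ a₀ ε₀ ε₂₉ B₃ B₃' a₀ a₁ (fun _ _ => 0) (fun _ _ => 0)) p i ^ 2) ε))) P) → OperandRowsAlongChain (gaussPinH (Stage13HParams.ofHistoryBlind F 2 ⟨theta13OfThm1CCMWZB F 2 j γ a₀ ε₀ ε₂₉ B₃ B₃' a₀ a₁ (Efl F j γ ε₀ ε₂₉ B₃ B₃' a₀ a₁) (fun p i => Real.log (B16ZLower.zNorm (SU 2) (gOfRecord₁₃ F 2 (theta13OfThm1CCMWZB F 2 j γ a₀ ε₀ ε₂₉ B₃ B₃' a₀ a₁ (fun _ _ => 0) (fun _ _ => 0)) p i ^ 2) ε)), ZrOfRecord₁₃ F 2 (theta13OfThm1CCMWZB F 2 j γ a₀ ε₀ ε₂₉ B₃ B₃' a₀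 a₁ (Efl F j γ ε₀ ε₂₉ B₃ B₃' a₀ a₁) (fun p i => Real.log (B16ZLower.zNorm (SU 2) (gOfRecord₁₃ F 2 (theta13OfThm1CCMWZB F 2 j γ a₀ ε₀ ε₂₉ B₃ B₃' a₀ a₁ (fun _ _ => 0) (fun _ _ => 0)) p i ^ 2) ε)))⟩)) P (σ P)))
    (hEfl : ∀ (F : T4Family) (j : ℕ) (γ ε₀ ε₂₉ B₃ B₃' a₀ a₁ : ℝ), ∃ CE : ℝ, 0 ≤ CE ∧ ∀ (P : B12.RunParams) (i : ℕ), i < P.K → |Efl F j γ ε₀ ε₂₉ B₃ B₃' a₀ a₁ P i| ≤ CE * sitesCard (F.P P.K) (i + 1))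
    (h13pos : ∀ (F : T4Family) {j : ℕ} {γ ε₀ ε₂₉ B₃ B₃' a₀ a₁ : ℝ} (hγ₀ : 0 < γ) (hγh : γ ≤ 1 / 2) (hε : 0 < ε₀) (hε' : 0 < ε₂₉) (hB : 0 ≤ B₃) (hB' : 0 ≤ B₃') (ha₀ : 0 < a₀) (ha₁ : 0 < a₁) (ha₀ρ : a₀ ≤ 1 / (109824 * (F.L : ℝ) ^ 2)) (hε₀ρ : ε₀ = a₀) {bl β' : ℝ} (hbox : BetaLowerH bl γ (betaOfRecord₁₃ F 2 (theta13OfThm1CCMWZB F 2 j γ a₀ ε₀ ε₂₉ B₃ B₃' a₀ a₁ (Efl F j γ ε₀ ε₂₉ B₃ B₃' a₀ a₁) (fun p i => Real.log (B16ZLower.zNorm (SU 2) (gOfRecord₁₃ F 2 (theta13OfThm1CCMWZB F 2 j γ a₀ ε₀ ε₂₉ B₃ B₃' a₀ a₁ (fun _ _ => 0) (fun _ _ => 0)) p i ^ 2) ε))))) (hbox' : BetaUpperH β' γ (betaOfRecord₁₃ F 2 (theta13OfThm1CCMWZB F 2 j γ a₀ ε₀ ε₂₉ B₃ B₃' a₀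 a₁ (Efl F j γ ε₀ ε₂₉ B₃ B₃' a₀ a₁) (fun p i => Real.log (B16ZLower.zNorm (SU 2) (gOfRecord₁₃ F 2 (theta13OfThm1CCMWZB F 2 j γ a₀ ε₀ ε₂₉ B₃ B₃' a₀ a₁ (fun _ _ => 0) (fun _ _ => 0)) p i ^ 2) ε))))) (hl : -bl * γ ^ 2 ≤ 3) (hβ' : β' * γ ^ 2 ≤ 3 / 4)
      (hP : (gaussPinH (Stage13HParams.ofHistoryBlind F 2 ⟨theta13OfThm1CCMWZB F 2 j γ a₀ ε₀ ε₂₉ B₃ B₃' a₀ a₁ (Efl F j γ ε₀ ε₂₉ B₃ B₃' a₀ a₁) (fun p i => Real.log (B16ZLower.zNorm (SU 2) (gOfRecord₁₃ F 2 (theta13OfThm1CCMWZB F 2 j γ a₀ ε₀ ε₂₉ B₃ B₃' a₀ a₁ (fun _ _ => 0) (fun _ _ => 0)) p i ^ 2) ε)), ZrOfRecord₁₃ F 2 (theta13OfThm1CCMWZB F 2 j γ a₀ ε₀ ε₂₉ B₃ B₃' a₀ a₁ (Efl F j γ ε₀ ε₂₉ B₃ B₃' a₀ a₁) (fun p i =>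 Real.log (B16ZLower.zNorm (SU 2) (gOfRecord₁₃ F 2 (theta13OfThm1CCMWZB F 2 j γ a₀ ε₀ ε₂₉ B₃ B₃' a₀ a₁ (fun _ _ => 0) (fun _ _ => 0)) p i ^ 2) ε)))⟩)).Provisos₁₃SepCoPH F 2),
      ∃ γ₁₃ : ℝ, 0 < γ₁₃ ∧ ∃ em ep : ℝ → ℝ,
        (∀ P : B12.RunParams, ((datumOfRecord₁₃SepCoPH F 2 (gaussPinH (Stage13HParams.ofHistoryBlind F 2 ⟨theta13OfThm1CCMWZB F 2 j γ a₀ ε₀ ε₂₉ B₃ B₃' a₀ a₁ (Efl F j γ ε₀ ε₂₉ B₃ B₃' a₀ a₁) (fun p i => Real.log (B16ZLower.zNorm (SU 2) (gOfRecord₁₃ F 2 (theta13OfThm1CCMWZB F 2 j γ a₀ ε₀ ε₂₉ B₃ B₃' a₀ a₁ (fun _ _ => 0) (fun _ _ => 0)) p i ^ 2) ε)), ZrOfRecord₁₃ F 2 (theta13OfThm1CCMWZB F 2 j γ a₀ ε₀ ε₂₉ B₃ B₃' a₀ a₁ (Efl F j γ ε₀ ε₂₉ B₃ B₃' a₀ a₁)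 (fun p i => Real.log (B16ZLower.zNorm (SU 2) (gOfRecord₁₃ F 2 (theta13OfThm1CCMWZB F 2 j γ a₀ ε₀ ε₂₉ B₃ B₃' a₀ a₁ (fun _ _ => 0) (fun _ _ => 0)) p i ^ 2) ε)))⟩)) hP).C P).flow.InInterval γ₁₃ P.K → ∀ k, k + 1 ≤ P.K → SLaw₁₃CoPH F 2 (gaussPinH (Stage13HParams.ofHistoryBlind F 2 ⟨theta13OfThm1CCMWZB F 2 j γ a₀ ε₀ ε₂₉ B₃ B₃' a₀ a₁ (Efl F j γ ε₀ ε₂₉ B₃ B₃' a₀ a₁) (fun p i => Real.log (B16ZLower.zNorm (SU 2) (gOfRecord₁₃ F 2 (theta13OfThm1CCMWZB F 2 j γ a₀ ε₀ ε₂₉ B₃ B₃' a₀ a₁ (fun _ _ => 0) (fun _ _ => 0)) p i ^ 2) ε)), ZrOfRecord₁₃ F 2 (theta13OfThm1CCMWZB F 2 j γ a₀ ε₀ ε₂₉ B₃ B₃' a₀ a₁ (Efl F j γ ε₀ ε₂₉ B₃ B₃' a₀ a₁) (fun p i => Real.log (B16ZLower.zNorm (SU 2) (gOfRecord₁₃ F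 2 (theta13OfThm1CCMWZB F 2 j γ a₀ ε₀ ε₂₉ B₃ B₃' a₀ a₁ (fun _ _ => 0) (fun _ _ => 0)) p i ^ 2) ε)))⟩)) P (k + 1) →
      ∀ᵐ U ∂(fieldMeasure (F.P P.K) (k + 1) (SU 2)),
        chiβOfRecord₁₃ F 2 (theta13OfThm1CCMWZB F 2 j γ a₀ ε₀ ε₂₉ B₃ B₃' a₀ a₁ (Efl F j γ ε₀ ε₂₉ B₃ B₃' a₀ a₁) (fun p i => Real.log (B16ZLower.zNorm (SU 2) (gOfRecord₁₃ F 2 (theta13OfThm1CCMWZB F 2 j γ a₀ ε₀ ε₂₉ B₃ B₃' a₀ a₁ (fun _ _ => 0) (fun _ _ => 0)) p i ^ 2) ε))) P.K (gOfRecord₁₃ F 2 (theta13OfThm1CCMWZB F 2 j γ a₀ ε₀ ε₂₉ B₃ B₃' a₀ a₁ (Efl F j γ ε₀ ε₂₉ B₃ B₃' a₀ a₁) (fun p i => Real.log (B16ZLower.zNorm (SU 2) (gOfRecord₁₃ F 2 (theta13OfThm1CCMWZB F 2 j γ a₀ ε₀ ε₂₉ B₃ B₃' a₀ a₁ (fun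 _ _ => 0) (fun _ _ => 0)) p i ^ 2) ε))) P) (k + 1) U *
              Real.exp (-(1 / (gOfRecord₁₃ F 2 (theta13OfThm1CCMWZB F 2 j γ a₀ ε₀ ε₂₉ B₃ B₃' a₀ a₁ (Efl F j γ ε₀ ε₂₉ B₃ B₃' a₀ a₁) (fun p i => Real.log (B16ZLower.zNorm (SU 2) (gOfRecord₁₃ F 2 (theta13OfThm1CCMWZB F 2 j γ a₀ ε₀ ε₂₉ B₃ B₃' a₀ a₁ (fun _ _ => 0) (fun _ _ => 0)) p i ^ 2) ε))) P (k + 1)) ^ 2 * wilsonBGOfRecord F 2 (theta13OfThm1CCMWZB F 2 j γ a₀ ε₀ ε₂₉ B₃ B₃' a₀ a₁ (Efl F j γ ε₀ ε₂₉ B₃ B₃' a₀ a₁) (fun p i => Real.log (B16ZLower.zNorm (SU 2) (gOfRecord₁₃ F 2 (theta13OfThm1CCMWZB F 2 j γ a₀ ε₀ ε₂₉ B₃ B₃' a₀ a₁ (fun _ _ => 0) (fun _ _ => 0)) p i ^ 2) ε))).εbg P (k + 1) U)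
                - em (gOfRecord₁₃ F 2 (theta13OfThm1CCMWZB F 2 j γ a₀ ε₀ ε₂₉ B₃ B₃' a₀ a₁ (Efl F j γ ε₀ ε₂₉ B₃ B₃' a₀ a₁) (fun p i => Real.log (B16ZLower.zNorm (SU 2) (gOfRecord₁₃ F 2 (theta13OfThm1CCMWZB F 2 j γ a₀ ε₀ ε₂₉ B₃ B₃' a₀ a₁ (fun _ _ => 0) (fun _ _ => 0)) p i ^ 2) ε))) P (k + 1)) * (Fintype.card (Site (F.P P.K) (k + 1)) : ℝ)) ≤ densOfRecord₁₃ F 2 (theta13OfThm1CCMWZB F 2 j γ a₀ ε₀ ε₂₉ B₃ B₃' a₀ a₁ (Efl F j γ ε₀ ε₂₉ B₃ B₃' a₀ a₁) (fun p i => Real.log (B16ZLower.zNorm (SU 2) (gOfRecord₁₃ F 2 (theta13OfThm1CCMWZB F 2 j γ a₀ ε₀ ε₂₉ B₃ B₃' a₀ a₁ (fun _ _ => 0) (fun _ _ => 0)) p i ^ 2) ε))) P (k + 1) U ∧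
          densOfRecord₁₃ F 2 (theta13OfThm1CCMWZB F 2 j γ a₀ ε₀ ε₂₉ B₃ B₃' a₀ a₁ (Efl F j γ ε₀ ε₂₉ B₃ B₃' a₀ a₁) (fun p i => Real.log (B16ZLower.zNorm (SU 2) (gOfRecord₁₃ F 2 (theta13OfThm1CCMWZB F 2 j γ a₀ ε₀ ε₂₉ B₃ B₃' a₀ a₁ (fun _ _ => 0) (fun _ _ => 0)) p i ^ 2) ε))) P (k + 1) U ≤ Real.exp (ep (gOfRecord₁₃ F 2 (theta13OfThm1CCMWZB F 2 j γ a₀ ε₀ ε₂₉ B₃ B₃' a₀ a₁ (Efl F j γ ε₀ ε₂₉ B₃ B₃' a₀ a₁) (fun p i => Real.log (B16ZLower.zNorm (SU 2) (gOfRecord₁₃ F 2 (theta13OfThm1CCMWZB F 2 j γ a₀ ε₀ ε₂₉ B₃ B₃' a₀ a₁ (fun _ _ => 0) (fun _ _ => 0)) p i ^ 2) ε))) P (k + 1)) * (Fintype.card (Site (F.P P.K) (k + 1)) : ℝ))))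
    -- ★ THE COFINAL β-SOCKET (director-ym №402 (R) ∕ P3 g84 spec (R1)): K0⁷'s sign-free β-BOX AND NODE O's four RUN ROWS AT A RADIUS SUPPLIED BY THE PRODUCER — for every ceiling `a > 0` SOME
    -- `0 < a₀ ≤ a`, SOME member letters `(j, ε₀, B₃, B₃′, a₁, Efl, logz)`, level `γ₀`, threshold `ε₂₉`, bound `β′` with the abs box of β₁₃ at the doors' HALF-WINDOW Z3 member
    -- (= the body of `K0V23Stub3DoorSuppliers.K0BoxCofinalRadii` ✓p781725 at `F`, conjunct for conjunct) ∧ NODE O's rows (i) (iv) (C) at THAT β at SOME level `γ₁` (K1⁹'s own rows conjunct);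
    -- replaces engine v2's `h3` (the ∀-radius V23 stub text) AND `hrowsRF` (the ∀-door run rows): the socket bills the producer at ITS radius, not at every small radius
    (hβc : ∀ F : T4Family, ∀ a : ℝ, 0 < a → ∃ a₀ : ℝ, 0 < a₀ ∧ a₀ ≤ a ∧
      ∃ (γ₀ ε₂₉ β' : ℝ) (j : ℕ) (ε₀ B₃ B₃' a₁ : ℝ) (Efl logz : B12.RunParams → ℕ → ℝ), 0 < γ₀ ∧ 0 < ε₂₉ ∧
        BetaLowerH (-β') γ₀ (betaOfRecord₁₃ F 2 (theta13OfThm1CCMWZB F 2 j (1 / 2) a₀ ε₀ ε₂₉ B₃ B₃' a₀ a₁ Efl logz)) ∧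
        BetaUpperH β' γ₀ (betaOfRecord₁₃ F 2 (theta13OfThm1CCMWZB F 2 j (1 / 2) a₀ ε₀ ε₂₉ B₃ B₃' a₀ a₁ Efl logz)) ∧
        ∃ (b : ℕ → ℝ) (r γ₁ M : ℝ), 0 < γ₁ ∧
          (∀ (n : ℕ) (gs : ℕ → ℝ), RGEqH n (betaOfRecord₁₃ F 2 (theta13OfThm1CCMWZB F 2 j (1 / 2) a₀ ε₀ ε₂₉ B₃ B₃' a₀ a₁ Efl logz)) gs → Step.InInterval γ₁ n gs → ∀ k, k ≤ n → |betaOfRecord₁₃ F 2 (theta13OfThm1CCMWZB F 2 j (1 / 2) a₀ ε₀ ε₂₉ B₃ B₃' a₀ a₁ Efl logz) k (prefixOf gs k) - b k| ≤ r) ∧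
          (∀ (n : ℕ) (gs : ℕ → ℝ), RGEqH n (betaOfRecord₁₃ F 2 (theta13OfThm1CCMWZB F 2 j (1 / 2) a₀ ε₀ ε₂₉ B₃ B₃' a₀ a₁ Efl logz)) gs → Step.InInterval γ₁ n gs → ∀ k, k ≤ n → -M ≤ ∑ i ∈ Finset.Ico k n, betaOfRecord₁₃ F 2 (theta13OfThm1CCMWZB F 2 j (1 / 2) a₀ ε₀ ε₂₉ B₃ B₃' a₀ a₁ Efl logz) i (prefixOf gs i)) ∧
          ∀ k : ℕ, ContinuousOn (fun x : ℝ => betaOfRecord₁₃ F 2 (theta13OfThm1CCMWZB F 2 j (1 / 2) a₀ ε₀ ε₂₉ B₃ B₃' a₀ a₁ Efl logz) k (clampPrefix (betaOfRecord₁₃ F 2 (theta13OfThm1CCMWZB F 2 j (1 / 2) a₀ ε₀ ε₂₉ B₃ B₃' a₀ a₁ Efl logz)) γ₁ k x))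
            {x : ℝ | 0 < x ∧ x ≤ γ₁ ∧ ∀ i, i ≤ k → 1 / γ₁ ^ 2 ≤ Y (betaOfRecord₁₃ F 2 (theta13OfThm1CCMWZB F 2 j (1 / 2) a₀ ε₀ ε₂₉ B₃ B₃' a₀ a₁ Efl logz)) γ₁ i x}) :
    Summit.QuantumFields.YangMills.Theses.BalabanUVNodes.StabilityBRunRowsAtRecordR13SepCoPHV := by
  intro F _
  exact N24_stabilityBRunRowsR13SepCoPHV_consequent_of_cofinalBetaSocketZBV23_of_childrenSplitSlot8DoorPinnedN09Thm3InputsN11SupplierRowsThm1AEPos_atGaussPinPrintedZB_pinY Slot8 ε hεz (Efl F)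
    (h05 F) (h06 F) (h07 F) (h08 F) (h09 F) (hN09T F) (h10 F) (h11N F) (hEfl F) (h13pos F) (hβc F)

end Summit.QuantumFields.YangMills.BalabanUVNodes.N24K1R9ByNameOfCofinalBetaSocketV23GridGBChildrenSplitSlot8Thm1AEPosN09T5AtGaussPinPrintedZBY

end
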